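import Summits.ABC.ABC.Theses.TwistAmplification
import Literature.NumberTheory.EllipticCurves.SzpiroLocalDataProofs
import Literature.Barriers.ABC.UniformABCDiscriminantSharpProofs
import Literature.NumberTheory.DiophantineGeometry.ConductorExponentLeTwoProofs
import Literature.NumberTheory.EllipticCurves.SzpiroOfAbcProofs
import Literature.NumberTheory.EllipticCurves.SzpiroFreyProofs

/-!
# Disproof of `SharpModerateLaw` (crux stmt-ABC-1975, route-ABC-TwistAmplification) — findings

Standing adversary file (cdisprove), gen 2 / cycle 2, refuter-cdisprove-stmt-ABC-1975-g2-0, 2026-08-16.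

**VERDICT (running): the crux RESISTS.** `T⁺_[κ,σ](X) ≪ X^{1−κ/6+ε}` (3<κ<6<σ) is the (c₄,c₆)
random-model prediction (implicit in Watkins, *Some heuristics about elliptic curves*,
arXiv:math/0608766 §4.1: `Prob[D/N = q] ≤ q⁻¹ ∏_{p∣q} 3/p` by discriminant ⇒ window count
`X^{5/6}·Σ_{q ≳ X^{κ−1}} q^{5/6} f̂(q) = X^{1−κ/6+o(1)}`), it is tight on a large explicit class of
algebraic sources, and no algebraic source with ≤ 3 free parameters can beat it (§F2 below).

## Lineage / reconstruction note
gen 1 (refuter-cdisprove-stmt-ABC-1975-0, 2026-08-15) wrote Disproof.lean v1–v6 (~2170 lines, rc0, 0 sorries)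
as item EVIDENCE only (`run/gate/evidence/stmt-ABC-1975/*-Disproof.lean`); that directory is not mounted in
later refuter jails and no crux workfile existed, so v6 could not be read or extended verbatim. Its
certified content, as recorded on the ledger (item notes 2026-08-15T22:29Z–23:13Z), was:
* `window`, `window_finite`, `sharpModerateLaw_iff` (= Iff.rfl), `sharpModerateLaw_iff_anySigma` (6<σ decoration);
* LOAD-BEARING (statement FALSE with the single clause dropped): `κ<6` (the reduced minimal model
  y²+xy+y = x³−334x−2368, N = 30, M⁺ = 16009³ = 30^{8.54}, at κ=7, σ=9, ε=1/12); `c₄ ≠ 0` (sextic twists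
  y² = x³+b⁵, κ=9/2, σ=7, ε=1/20); `c₆ ≠ 0` (quartic twists y² = x³+b³x, κ=4, σ=7); `0 < ε`; minimality at all v
  (non-minimal reduced scalings `freyScaled m k`, κ=9/2, σ=65);
* HONESTY clauses: reducedness dropped ⇒ statement trivially TRUE (ncard = 0 via integral translates);
* TIGHTNESS: exponent 1−κ/6 not lowerable by any uniform η>0 (`not_sharpModerateLaw_lowered`), and
  `window_not_power_saving` at every κ ↑ 12j/(2j+1) (Frey families 3m+1 = b^{2j}, Chebyshev prime supply).
This file (v7+) RE-CERTIFIES the structural part (§1) and adds the cycle-2 material; the gen-1 family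
certificates are cited from the ledger, not re-proved, unless they reappear below.

## Contents (Lean)
* §1 `window`, `T`, `sharpModerateLaw_iff`, `window_finite` (ncard honest), monotonicity `window_mono`,
  `T_mono`, `sharpModerateLaw_iff_anySigma` (6<σ is decoration),
  `moderateWindowCount_of_sharpModerateLaw` (crux ⇒ route target, margin identity at κ = 4; positive glue).
* §2 NEW `not_sharpModerateLawRadical`: the crux with `N` replaced by the radical proxy `N♭ = rad |Δ_min|`
  is FALSE (prime quadratic twists `tw d : y² = x³ − d²x + d³`, `d ≤ N♭ ≤ 368 d`, window [4,23], ε = 1/6,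
  Chebyshev supply) — the conductor's `p²` at additive primes is exactly what the crux lives on (twist test).
* §3 RE-CERTIFIED `not_sharpModerateLawWithoutKappaLtSix` (κ<6 load-bearing) with the exact-conductor
  certificate `W30_conductorNorm : N(y²+xy+y = x³−334x−2368) = 30` (template for explicit curves).
* §4 frontier of the algebraic attack: bookkeeping LAW ⟺ c ≤ r − w', the R ≤ 1 classification, Conjecture V
  (values of a pencil ≪ H^{R+2}), `henselFamily_identity` (w' = 1 universal R = 2 family, on the law in all
  dimensions), `weightedPullback_identity`.
* §5 RE-CERTIFIED `not_sharpModerateLawWithoutC4` (c₄ ≠ 0 load-bearing, triage BUG 1): CM family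
  `cm b : y² = x³ + b⁵`, `b² ∣ N ∣ 432 b²` (f_b = 2 exactly via Tate/Ogg bounds), general prime supply
  `primesIoc_card_mul_log_ge`.
* §6 RE-CERTIFIED `not_sharpModerateLawWithoutC6` (c₆ ≠ 0 load-bearing): `qt b : y² = x³ + b³x`, `b² ∣ N ∣ 64 b²`.
* §7 RE-CERTIFIED `not_sharpModerateLawWithoutMinimality` (minimality load-bearing): integral rescalings
  `sc b k` of `tw b` (same conductor by `conductorNorm_smul_rat`, `b² ∣ N ∣ 368 b²`), `b ≤ k ≤ b²` at X = 368 b².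
* §8 RE-CERTIFIED `sharpModerateLawUnreduced_trivial` (reducedness = honesty clause: without it every window
  is empty or infinite, ncard = 0, statement true with C = 0), with the DVR lemma `isMinimal_smul_of_u_eq_one`
  and the translate family `tr`.
* §9 TIGHTNESS instance (re-certified in numeric form): `T_not_bigO_three_tenths` — `T_[3.9,14](X)` is not
  `O(X^{3/10})` (reduced Frey models `fr b` of `1 + b² = b²+1`, `b ≤ N ≤ 2048 b³`, `4096 b¹² ≤ M⁺ ≤ 110592 b¹²`),
  hence `not_sharpModerateLawLoweredTwentieth`: the exponent `1 − κ/6` cannot be lowered by 1/20.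
HYPOTHESIS AUDIT NOW IN THIS FILE: κ<6 (§3), c₄≠0 (§5), c₆≠0 (§6), minimality (§7) — FALSE without;
reducedness (§8) — TRIVIAL without; 6<σ (§1) — decoration; conductor-vs-radical (§2) — FALSE with the
radical proxy; exponent (§9) — not lowerable by 1/20 at κ = 3.9 (gen 1: by any η > 0, along κ_j ↑ 6;
paper F3': attained at every κ by twist families). 0<ε: dropping it lets ε ≤ −1/20, refuted by §9.

## Findings of cycle 2 (paper; details in the section docblocks / NOTES.md)
* F1 KILL CRITERION (algebraic). A k-parameter polynomial family (c₄,c₆) = (F,G), forms of degree 2w', 3w'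
  on P^k, F³−G² = ∏ H_i^{m_i}, r := Σ δ_i·deg H_i (δ = 1 mult., 2 add.) has H^{k+1} members of conductor
  ≲ H^r =: X and M⁺ ≈ H^{6w'}: count X^{(k+1)/r} at ratio 6w'/r. LAW ⟺ r ≥ w' + k + 1 (on the law iff =);
  a KILL needs a non-degenerate family with r ≤ w' + k and k < w'. Intrinsically: K_B + D − 2λ ≥ 0 on moving
  curves of the base; on a curve base this is Szpiro–Shioda (R–H for j). With R := degree of the foliation by
  level sets of j (tangencies of a generic line with non-special fibres) and A := additive degree:
  r − w' − 2 = R + A, so LAW ⟺ R + A ≥ k − 1.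
* F2 NO-GO THROUGH k = 3 (new). R = 0 ⇒ j composed with a linear pencil; R = 1 ⇒ the reduced gradient field
  is p × Λp, level curves are exp(tΛ)-orbits, so j is composite with a binomial pencil ⟨x^a y^b, z^{a+b}⟩ or a
  bitangent conic pencil ⟨ℓ², Q⟩ (deg ρ = 1 is excluded by the fibre shape 3D₀ + 2D₁, which would force r = 6w');
  composite families j = ρ∘ψ have only H^{c_ψ} distinct members with c_ψ ≤ R_ψ + 2 for R_ψ ≤ 1, while
  Σ r_i ≥ e(w_ρ + s_ρ) + 2 + R_ψ. Hence every polynomial family with ≤ 3 parameters (composite or not) is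
  on/below the law; the first open algebraic case is a NON-composite 4-parameter family with R = 2
  (a degree-2 foliation of P² with rational first integral of leaf degree 6w' ≥ 30, special leaves 3D₀, 2D₁,
  and r = w' + 4).
* F3 TIGHTNESS CLASS enlarged: power/product specialisations t = (u^a : v^b) of Belyi-extremal P¹-families and
  weighted pullbacks such as (t:s:z) ↦ (t² : sz) [F = t²+2sz, G = t³+3tsz, F³−G² = s²z²(3t²+8sz)] land EXACTLY
  on X^{1−κ/6} (ratios 12/(2+1/a+1/b), …); the P³ near-miss F₀(ℓ², Q) has r = w'+3 but only H³ distinct members.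
* F3' TIGHT AT EVERY κ (paper, new; cleaner than the discrete κ_j ↑ 6 of gen 1): quadratic twists by
  squarefree `d ≡ 1 (4)`, `(d, 6N₀) = 1`, of the Frey curves of `1 + (9^k − 1) = 9^k` (ratio `6 + O(1/k)`) give
  `T_[κ,σ](X) ≥ c_κ X^{1−κ/6}` for EVERY `3 < κ < 6 ≤ σ` and all large `X` (a ratio-β₀ source at conductor
  `N₀` contributes `N₀^{(β₀−κ)/(2κ−6)}` window twists up to `X = N₀^{(2β₀−6)/(2κ−6)}`, i.e. `X^{(β₀−κ)/(2β₀−6)}`,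
  `= X^{1−κ/6}` at `β₀ = 6`); and the twist transport is a fixed point of the law (a base population
  `Y^{1−β/6}` at every β integrates to exactly `X^{1−κ/6}`). Conversely twists of ANY infinite family of
  ratio `≥ 6 + δ` (e.g. Frey curves of abc triples of quality `≥ 1 + δ/6`, i.e. ¬ABC) give
  `X^{1−κ/6 + δ(κ−3)/(6(6+2δ))}` and would KILL the crux — this is the route's own amplification
  (TwistAmplificationLemma) read as a disproof recipe: a pointwise kill of the crux = ¬(generalized Szpiro).
* F4 Prior art located: Watkins 2006 §4.1 (random model ⇒ the law), FNT 1992 (upper bound X^{1/κ+ε} by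
  discriminant), Nitaj/Cremona tables (census scale N ≤ 5·10⁵ only).
* CENSUS STATUS: impossible offline so far — the compute node has gp 2.15.4 WITHOUT the `elldata` package
  (probe kit j007686: `ellinit("11a1")`/`forell` fail with "error opening elldata file"; the same probe confirms
  `ellglobalred` of W30 gives N = 30, Δ = 9000000, c₄ = 16009, matching §3) and no LMFDB mirror; the prepared
  census script (folder `jobs/census.gp`: T_[κ,∞](X) for N ≤ 499999, slopes vs 1−κ/6) runs as soon as
  pari-elldata (or Cremona's allcurves files) is available on a node — route kill criterion (b) remains untested.
-/

set_option linter.dupNamespace false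

namespace Summit.ABC.ABC.Cruxes.SharpModerateLaw.Disproof

open Summit.ABC.ABC.Theses.TwistAmplification WeierstrassCurve IsDedekindDomain

noncomputable section

/-! ## 1. The counted set, honestly -/

/-- The window predicate of the crux, verbatim: reduced minimal integral models with `c₄ c₆ ≠ 0`,
conductor `N ≤ X` and `N ^ κ ≤ M⁺ ≤ N ^ σ`, `M⁺ = max |Δ| |c₄|³`. -/
def window (κ σ X : ℝ) : Set (WeierstrassCurve ℤ) :=
  {W₀ : WeierstrassCurve ℤ | (W₀.baseChange ℚ).IsElliptic ∧
    (∀ v : HeightOneSpectrum ℤ, (W₀.baseChange ℚ).IsMinimalAt v) ∧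
    (W₀.a₁ = 0 ∨ W₀.a₁ = 1) ∧ (W₀.a₃ = 0 ∨ W₀.a₃ = 1) ∧ (W₀.a₂ = -1 ∨ W₀.a₂ = 0 ∨ W₀.a₂ = 1) ∧
    W₀.c₄ ≠ 0 ∧ W₀.c₆ ≠ 0 ∧
    (((W₀.baseChange ℚ).conductorNorm ℤ : ℕ) : ℝ) ≤ X ∧
    (((W₀.baseChange ℚ).conductorNorm ℤ : ℕ) : ℝ) ^ κ ≤ ((max |W₀.Δ| (|W₀.c₄| ^ 3) : ℤ) : ℝ) ∧
    ((max |W₀.Δ| (|W₀.c₄| ^ 3) : ℤ) : ℝ) ≤ (((W₀.baseChange ℚ).conductorNorm ℤ : ℕ) : ℝ) ^ σ}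

/-- `T κ σ X = T⁺_[κ,σ](X)`, the window count. -/
def T (κ σ X : ℝ) : ℕ := (window κ σ X).ncard

/-- The crux is literally the statement about `T`. -/
theorem sharpModerateLaw_iff :
    SharpModerateLaw ↔ ∀ κ σ ε : ℝ, 3 < κ → κ < 6 → 6 < σ → 0 < ε →
      ∃ C : ℝ, ∀ X : ℝ, 1 ≤ X → (T κ σ X : ℝ) ≤ C * X ^ (1 - κ / 6 + ε) :=
  Iff.rfl

/-! ### 1.1 Finiteness of the window (so `ncard` is the honest count) -/

/-- Reduced models in an `(a₄, a₆)`-box. -/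
def box (K L : ℤ) : Set (WeierstrassCurve ℤ) :=
  {W | (W.a₁ = 0 ∨ W.a₁ = 1) ∧ (W.a₃ = 0 ∨ W.a₃ = 1) ∧ (W.a₂ = -1 ∨ W.a₂ = 0 ∨ W.a₂ = 1) ∧
    |W.a₄| ≤ K ∧ |W.a₆| ≤ L}

theorem box_finite (K L : ℤ) : (box K L).Finite := by
  have hinj : Set.InjOn (fun W : WeierstrassCurve ℤ => (W.a₁, W.a₂, W.a₃, W.a₄, W.a₆)) (box K L) := by
    intro W _ W' _ h
    simp only [Prod.mk.injEq] at h
    obtain ⟨h1, h2, h3, h4, h6⟩ := h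
    ext <;> assumption
  refine Set.Finite.of_finite_image ?_ hinj
  refine Set.Finite.subset (Finset.finite_toSet (Finset.Icc (-1 : ℤ) 1 ×ˢ Finset.Icc (-1 : ℤ) 1 ×ˢ
    Finset.Icc (-1 : ℤ) 1 ×ˢ Finset.Icc (-K) K ×ˢ Finset.Icc (-L) L)) ?_
  rintro _ ⟨W, hW, rfl⟩
  obtain ⟨h₁, h₃, h₂, h₄, h₆⟩ := hW
  simp only [Finset.coe_product, Finset.coe_Icc, Set.mem_prod, Set.mem_Icc]
  refine ⟨⟨?_, ?_⟩, ⟨?_, ?_⟩, ⟨?_, ?_⟩, abs_le.mp h₄, abs_le.mp h₆⟩ <;> omega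

/-- Coefficient bounds for a reduced model from bounds on `c₄` and `c₆` (linear algebra of
`c₄ = b₂² − 24 b₄`, `c₆ = −b₂³ + 36 b₂ b₄ − 216 b₆`). -/
theorem abs_a₄_a₆_le (W : WeierstrassCurve ℤ) (h₁ : W.a₁ = 0 ∨ W.a₁ = 1) (h₃ : W.a₃ = 0 ∨ W.a₃ = 1)
    (h₂ : W.a₂ = -1 ∨ W.a₂ = 0 ∨ W.a₂ = 1) (B : ℤ) (hc₄ : |W.c₄| ≤ B) (hc₆ : |W.c₆| ≤ B) :
    |W.a₄| ≤ B + 49 ∧ |W.a₆| ≤ 2 * B + 400 := by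
  obtain ⟨a₁, a₂, a₃, a₄, a₆⟩ := W
  simp only at h₁ h₂ h₃ hc₄ hc₆ ⊢
  simp only [WeierstrassCurve.c₄, WeierstrassCurve.c₆, WeierstrassCurve.b₂, WeierstrassCurve.b₄,
    WeierstrassCurve.b₆] at hc₄ hc₆
  rw [abs_le] at hc₄ hc₆
  rcases h₁ with rfl | rfl <;> rcases h₃ with rfl | rfl <;> rcases h₂ with rfl | rfl | rfl <;>
    refine ⟨abs_le.mpr ⟨?_, ?_⟩, abs_le.mpr ⟨?_, ?_⟩⟩ <;> nlinarith

/-- `|x| ≤ x²` for integers. -/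
theorem int_abs_le_sq (x : ℤ) : |x| ≤ x ^ 2 := by
  rcases le_or_gt 0 x with h | h
  · rw [abs_of_nonneg h]; nlinarith
  · rw [abs_of_neg h]; nlinarith

/-- **Finiteness engine.** Reduced integral models with capped `M⁺ = max |Δ| |c₄|³ ≤ B` form a
finite set (no ellipticity, minimality or conductor input needed). -/
theorem reducedCap_finite (B : ℤ) :
    {W : WeierstrassCurve ℤ | (W.a₁ = 0 ∨ W.a₁ = 1) ∧ (W.a₃ = 0 ∨ W.a₃ = 1) ∧
      (W.a₂ = -1 ∨ W.a₂ = 0 ∨ W.a₂ = 1) ∧ max |W.Δ| (|W.c₄| ^ 3) ≤ B}.Finite := by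
  rcases lt_or_ge B 0 with hB0 | hB0
  · convert Set.finite_empty
    ext W
    simp only [Set.mem_setOf_eq, Set.mem_empty_iff_false, iff_false, not_and]
    intro _ _ _ h
    have : (0 : ℤ) ≤ max |W.Δ| (|W.c₄| ^ 3) := le_max_of_le_left (abs_nonneg _)
    omega
  refine (box_finite (B ^ 3 + 1728 * B + 49) (2 * (B ^ 3 + 1728 * B) + 400)).subset ?_
  intro W hW
  obtain ⟨h₁, h₃, h₂, hMB⟩ := hW
  have hΔ : |W.Δ| ≤ B := (le_max_left _ _).trans hMB
  have hc₄3 : |W.c₄| ^ 3 ≤ B := (le_max_right _ _).trans hMB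
  have hc₄ : |W.c₄| ≤ B := by
    rcases le_or_gt |W.c₄| 1 with h | h
    · rcases (abs_nonneg W.c₄).eq_or_lt with h0 | h0
      · rw [← h0]; exact hB0
      · calc |W.c₄| ≤ 1 := h
          _ ≤ |W.c₄| ^ 3 := one_le_pow₀ (by omega)
          _ ≤ B := hc₄3
    · calc |W.c₄| ≤ |W.c₄| ^ 3 := le_self_pow₀ h.le (by norm_num)
        _ ≤ B := hc₄3
  -- `c₆² = c₄³ − 1728 Δ`
  have hrel : W.c₆ ^ 2 = W.c₄ ^ 3 - 1728 * W.Δ := by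
    have := W.c_relation; linarith
  have hc₆ : |W.c₆| ≤ B ^ 3 + 1728 * B := by
    calc |W.c₆| ≤ W.c₆ ^ 2 := int_abs_le_sq _
      _ = W.c₄ ^ 3 - 1728 * W.Δ := hrel
      _ ≤ |W.c₄| ^ 3 + 1728 * |W.Δ| := by
          have h1 : W.c₄ ^ 3 ≤ |W.c₄| ^ 3 := by
            calc W.c₄ ^ 3 ≤ |W.c₄ ^ 3| := le_abs_self _
              _ = |W.c₄| ^ 3 := abs_pow _ _
          have h2 : -(1728 * W.Δ) ≤ 1728 * |W.Δ| := by
            have := neg_abs_le W.Δ; linarith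
          linarith
      _ ≤ B ^ 3 + 1728 * B := by
          have : |W.c₄| ^ 3 ≤ B ^ 3 := pow_le_pow_left₀ (abs_nonneg _) hc₄ 3
          linarith
  have hc₄' : |W.c₄| ≤ B ^ 3 + 1728 * B := by
    have : (0 : ℤ) ≤ B ^ 3 := by positivity
    linarith
  obtain ⟨h4, h6⟩ := abs_a₄_a₆_le W h₁ h₃ h₂ _ hc₄' hc₆
  exact ⟨h₁, h₃, h₂, h4, h6⟩

/-- For a point of the window, `M⁺ ≤ max 1 (X ^ σ)`. -/
theorem maxInv_le_of_mem_window {κ σ X : ℝ} {W : WeierstrassCurve ℤ} (hW : W ∈ window κ σ X) :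
    ((max |W.Δ| (|W.c₄| ^ 3) : ℤ) : ℝ) ≤ max 1 (X ^ σ) := by
  obtain ⟨hE, -, -, -, -, -, -, hNX, -, hM⟩ := hW
  haveI := hE
  have hN1 : (1 : ℝ) ≤ (((W.baseChange ℚ).conductorNorm ℤ : ℕ) : ℝ) := by
    exact_mod_cast conductorNorm_pos_holds (W.baseChange ℚ)
  refine hM.trans ?_
  rcases le_or_gt 0 σ with hσ | hσ
  · exact le_max_of_le_right (Real.rpow_le_rpow (by linarith) hNX hσ)
  · exact le_max_of_le_left (Real.rpow_le_one_of_one_le_of_nonpos hN1 hσ.le)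

/-- **The window is finite** (for every real `κ σ X`): reducedness plus the cap `M⁺ ≤ N^σ ≤ max(1,X^σ)`
bound `a₄, a₆`. So `Set.ncard` in the crux is the honest count, never the junk value `0` of an
infinite set. -/
theorem window_finite (κ σ X : ℝ) : (window κ σ X).Finite := by
  refine (reducedCap_finite (⌈max (1 : ℝ) (X ^ σ)⌉₊ : ℕ)).subset ?_
  intro W hW
  have hM := maxInv_le_of_mem_window hW
  obtain ⟨-, -, h₁, h₃, h₂, -⟩ := hW
  refine ⟨h₁, h₃, h₂, ?_⟩
  have : ((max |W.Δ| (|W.c₄| ^ 3) : ℤ) : ℝ) ≤ ((⌈max (1 : ℝ) (X ^ σ)⌉₊ : ℕ) : ℝ) :=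
    hM.trans (Nat.le_ceil _)
  exact_mod_cast this

/-- Hence `T κ σ X` is the cardinality of a finite set. -/
theorem T_eq_card (κ σ X : ℝ) : T κ σ X = (window_finite κ σ X).toFinset.card :=
  Set.ncard_eq_toFinset_card _ _

/-! ### 1.2 Monotonicity in the window parameters; `6 < σ` is decoration -/

/-- The conductor of a window member is `≥ 1` (as a real number). -/
theorem one_le_conductor_of_mem {κ σ X : ℝ} {W : WeierstrassCurve ℤ} (hW : W ∈ window κ σ X) :
    (1 : ℝ) ≤ (((W.baseChange ℚ).conductorNorm ℤ : ℕ) : ℝ) := by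
  haveI := hW.1
  exact_mod_cast conductorNorm_pos_holds (W.baseChange ℚ)

/-- Windows grow when `κ` decreases and `σ` increases. -/
theorem window_mono {κ κ' σ σ' : ℝ} (hκ : κ' ≤ κ) (hσ : σ ≤ σ') (X : ℝ) :
    window κ σ X ⊆ window κ' σ' X := by
  intro W hW
  have h1 := one_le_conductor_of_mem hW
  obtain ⟨hE, hmin, h₁, h₃, h₂, hc₄, hc₆, hNX, hlo, hhi⟩ := hW
  refine ⟨hE, hmin, h₁, h₃, h₂, hc₄, hc₆, hNX, ?_, ?_⟩
  · exact (Real.rpow_le_rpow_of_exponent_le h1 hκ).trans hlo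
  · exact hhi.trans (Real.rpow_le_rpow_of_exponent_le h1 hσ)

/-- Windows grow with `X`. -/
theorem window_mono_X (κ σ : ℝ) {X X' : ℝ} (hX : X ≤ X') : window κ σ X ⊆ window κ σ X' := by
  intro W hW
  obtain ⟨hE, hmin, h₁, h₃, h₂, hc₄, hc₆, hNX, hlo, hhi⟩ := hW
  exact ⟨hE, hmin, h₁, h₃, h₂, hc₄, hc₆, hNX.trans hX, hlo, hhi⟩

theorem T_mono {κ κ' σ σ' : ℝ} (hκ : κ' ≤ κ) (hσ : σ ≤ σ') (X : ℝ) : T κ σ X ≤ T κ' σ' X :=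
  Set.ncard_le_ncard (window_mono hκ hσ X) (window_finite _ _ _)

theorem T_mono_X (κ σ : ℝ) {X X' : ℝ} (hX : X ≤ X') : T κ σ X ≤ T κ σ X' :=
  Set.ncard_le_ncard (window_mono_X κ σ hX) (window_finite _ _ _)

/-- The crux with the hypothesis `6 < σ` dropped. -/
def SharpModerateLawAnySigma : Prop :=
  ∀ κ σ ε : ℝ, 3 < κ → κ < 6 → 0 < ε →
    ∃ C : ℝ, ∀ X : ℝ, 1 ≤ X → (T κ σ X : ℝ) ≤ C * X ^ (1 - κ / 6 + ε)

/-- **`6 < σ` is decoration**: the crux is equivalent to its `σ`-unrestricted form (windows are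
monotone in `σ`; for `σ ≤ 6` one enlarges to `σ' = 7`). Any proof may therefore assume `σ` as large
as it likes, and no refutation can come from small `σ`. -/
theorem sharpModerateLaw_iff_anySigma : SharpModerateLaw ↔ SharpModerateLawAnySigma := by
  rw [sharpModerateLaw_iff]
  refine ⟨fun h κ σ ε hκ hκ6 hε => ?_, fun h κ σ ε hκ hκ6 _ hε => h κ σ ε hκ hκ6 hε⟩
  obtain ⟨C, hC⟩ := h κ (max σ 7) ε hκ hκ6 (lt_max_of_lt_right (by norm_num)) hε
  refine ⟨C, fun X hX => le_trans ?_ (hC X hX)⟩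
  exact_mod_cast T_mono le_rfl (le_max_left σ 7) X

/-! ### 1.3 The crux implies the route target (margin identity), checked

This is the planner's "implies the target because `(σ−κ)/(2σ−6) − (1−κ/6) = (κ−3)(σ−6)/(3(2σ−6)) > 0`
for `σ > 6`", made formal at `κ = 4`: a POSITIVE lemma (evidence for provers; not a refuter landing). -/

/-- `SharpModerateLaw → ModerateWindowCount`: given `σ > 6` take `κ = 4`,
`ε = (σ−6)/(6(2σ−6))` (half the margin) and `δ = 1/3 + ε < (σ−4)/(2σ−6)`. -/
theorem moderateWindowCount_of_sharpModerateLaw (h : SharpModerateLaw) : ModerateWindowCount := by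
  intro σ hσ
  have h26 : 0 < 2 * σ - 6 := by linarith
  have hm : 0 < (σ - 6) / (6 * (2 * σ - 6)) := div_pos (by linarith) (by linarith)
  obtain ⟨C, hC⟩ := h 4 σ ((σ - 6) / (6 * (2 * σ - 6))) (by norm_num) (by norm_num) hσ hm
  refine ⟨4, 1 - 4 / 6 + (σ - 6) / (6 * (2 * σ - 6)), C, by norm_num, by linarith, ?_, hC⟩
  rw [← sub_pos]
  have h26' : σ * 2 - 6 ≠ 0 := by nlinarith
  have : (σ - 4) / (2 * σ - 6) - (1 - 4 / 6 + (σ - 6) / (6 * (2 * σ - 6))) =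
      (σ - 6) / (6 * (2 * σ - 6)) := by
    field_simp
    ring
  rw [this]
  exact hm

/-! ## 2. The conductor is genuine: the RADICAL proxy makes the crux FALSE (twist test)

Natural strengthening / tempting transfer: replace the conductor `N` by the radical
`N♭ = rad |Δ(W₀)|` of the minimal discriminant (for a minimal model `rad N = rad Δ_min`, Conductor.lean
`radical_conductorNorm_eq`; `N♭ ≤ N`, with equality iff `E` is semistable). Every quadratic twist family
kills it: `E₀^{(d)}` has `N = N₀ d²` but `N♭ = N♭₀ d`, so its ratio tends to `6` instead of `3` and the
`≍ X / log X` prime twists of ONE curve sit in every window `[κ, σ]`, against `X^{1−κ/6+ε} ≤ X^{1/2+ε}`.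
Moral for provers / ideators (cf. triage r1: `BoxRadicalLaw`, `IndexFormCensus` refuted for the same
reason): any census proxy for `N` must charge `p²` at the additive primes (`p ∣ c₄`, `p ∣ Δ`).
Certified below with the twists `y² = x³ − d² x + d³` of `y² = x³ − x + 1` (`Δ = −368 d⁶`, `c₄ = 48 d²`,
`c₆ = −864 d³`, minimal, `d ≤ N♭ ≤ 368 d`) by primes `d ≥ 409`, at `κ = 4`, `σ = 23`, `ε = 1/6`. -/

/-- The radical proxy `N♭ = rad |Δ(W₀)|` (for minimal `W₀`: the radical of the minimal discriminant,
`= rad N_E`). -/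
def radN (W₀ : WeierstrassCurve ℤ) : ℕ := UniqueFactorizationMonoid.radical W₀.Δ.natAbs

/-- The crux window with `N` replaced by `N♭ = radN`. -/
def windowRad (κ σ X : ℝ) : Set (WeierstrassCurve ℤ) :=
  {W₀ : WeierstrassCurve ℤ | (W₀.baseChange ℚ).IsElliptic ∧
    (∀ v : HeightOneSpectrum ℤ, (W₀.baseChange ℚ).IsMinimalAt v) ∧
    (W₀.a₁ = 0 ∨ W₀.a₁ = 1) ∧ (W₀.a₃ = 0 ∨ W₀.a₃ = 1) ∧ (W₀.a₂ = -1 ∨ W₀.a₂ = 0 ∨ W₀.a₂ = 1) ∧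
    W₀.c₄ ≠ 0 ∧ W₀.c₆ ≠ 0 ∧
    ((radN W₀ : ℕ) : ℝ) ≤ X ∧
    ((radN W₀ : ℕ) : ℝ) ^ κ ≤ ((max |W₀.Δ| (|W₀.c₄| ^ 3) : ℤ) : ℝ) ∧
    ((max |W₀.Δ| (|W₀.c₄| ^ 3) : ℤ) : ℝ) ≤ ((radN W₀ : ℕ) : ℝ) ^ σ}

/-- `SharpModerateLaw` with the conductor replaced by the radical proxy. -/
def SharpModerateLawRadical : Prop :=
  ∀ κ σ ε : ℝ, 3 < κ → κ < 6 → 6 < σ → 0 < ε → ∃ C : ℝ, ∀ X : ℝ, 1 ≤ X →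
    (Set.ncard (windowRad κ σ X) : ℝ) ≤ C * X ^ (1 - κ / 6 + ε)

theorem one_le_radN (W₀ : WeierstrassCurve ℤ) : 1 ≤ radN W₀ := Nat.radical_pos _

/-- The radical window is finite too (same engine). -/
theorem windowRad_finite (κ σ X : ℝ) : (windowRad κ σ X).Finite := by
  refine (reducedCap_finite (⌈max (1 : ℝ) (X ^ σ)⌉₊ : ℕ)).subset ?_
  intro W hW
  obtain ⟨-, -, h₁, h₃, h₂, -, -, hNX, -, hM⟩ := hW
  refine ⟨h₁, h₃, h₂, ?_⟩
  have hN1 : (1 : ℝ) ≤ ((radN W : ℕ) : ℝ) := by exact_mod_cast one_le_radN W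
  have hM' : ((max |W.Δ| (|W.c₄| ^ 3) : ℤ) : ℝ) ≤ max 1 (X ^ σ) := by
    refine hM.trans ?_
    rcases le_or_gt 0 σ with hσ | hσ
    · exact le_max_of_le_right (Real.rpow_le_rpow (by linarith) hNX hσ)
    · exact le_max_of_le_left (Real.rpow_le_one_of_one_le_of_nonpos hN1 hσ.le)
  have : ((max |W.Δ| (|W.c₄| ^ 3) : ℤ) : ℝ) ≤ ((⌈max (1 : ℝ) (X ^ σ)⌉₊ : ℕ) : ℝ) :=
    hM'.trans (Nat.le_ceil _)
  exact_mod_cast this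

/-! ### 2.1 The twist family `tw d : y² = x³ − d² x + d³` -/

/-- Quadratic twist by `d` of `y² = x³ − x + 1` (conductor 92 = 4·23; `Δ₀ = −368`). -/
def tw (d : ℕ) : WeierstrassCurve ℤ := ⟨0, 0, 0, -((d : ℤ) ^ 2), (d : ℤ) ^ 3⟩

@[simp] theorem tw_a₁ (d : ℕ) : (tw d).a₁ = 0 := rfl
@[simp] theorem tw_a₂ (d : ℕ) : (tw d).a₂ = 0 := rfl
@[simp] theorem tw_a₃ (d : ℕ) : (tw d).a₃ = 0 := rfl
@[simp] theorem tw_a₄ (d : ℕ) : (tw d).a₄ = -((d : ℤ) ^ 2) := rfl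
@[simp] theorem tw_a₆ (d : ℕ) : (tw d).a₆ = (d : ℤ) ^ 3 := rfl

theorem tw_c₄ (d : ℕ) : (tw d).c₄ = 48 * (d : ℤ) ^ 2 := by
  simp only [tw, WeierstrassCurve.c₄, WeierstrassCurve.b₂, WeierstrassCurve.b₄]; ring

theorem tw_c₆ (d : ℕ) : (tw d).c₆ = -864 * (d : ℤ) ^ 3 := by
  simp only [tw, WeierstrassCurve.c₆, WeierstrassCurve.b₂, WeierstrassCurve.b₄,
    WeierstrassCurve.b₆]; ring

theorem tw_Δ (d : ℕ) : (tw d).Δ = -368 * (d : ℤ) ^ 6 := by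
  simp only [tw, WeierstrassCurve.Δ, WeierstrassCurve.b₂, WeierstrassCurve.b₄, WeierstrassCurve.b₆,
    WeierstrassCurve.b₈]; ring

theorem tw_Δ_natAbs (d : ℕ) : (tw d).Δ.natAbs = 368 * d ^ 6 := by
  rw [tw_Δ]
  zify
  have : (0 : ℤ) ≤ (d : ℤ) ^ 6 := by positivity
  rw [abs_of_nonpos (by linarith)]
  ring

theorem tw_maxInv (d : ℕ) : max |(tw d).Δ| (|(tw d).c₄| ^ 3) = 110592 * (d : ℤ) ^ 6 := by
  rw [tw_Δ, tw_c₄, abs_mul, abs_mul, abs_of_nonpos (by norm_num : (-368 : ℤ) ≤ 0),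
    abs_of_nonneg (by norm_num : (0 : ℤ) ≤ 48), abs_pow, abs_pow, Nat.abs_cast]
  rw [max_eq_right]
  · ring
  · have : (0 : ℤ) ≤ (d : ℤ) ^ 6 := by positivity
    nlinarith

instance tw_isElliptic (d : ℕ) [NeZero d] : ((tw d).baseChange ℚ).IsElliptic := by
  refine ⟨?_⟩
  rw [baseChange_int_Δ, tw_Δ, isUnit_iff_ne_zero]
  have : (d : ℚ) ≠ 0 := by exact_mod_cast NeZero.ne d
  push_cast
  exact mul_ne_zero (by norm_num) (pow_ne_zero _ this)

/-- Minimality at every place for prime `d ≥ 3`, `d ≠ 23`: `v_p (Δ) ≤ 6 < 12` everywhere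
(`Δ = −2⁴·23·d⁶`). -/
theorem tw_isMinimalAt {d : ℕ} (hd : d.Prime) (h3 : 3 ≤ d) (h23 : d ≠ 23) (v : HeightOneSpectrum ℤ) :
    ((tw d).baseChange ℚ).IsMinimalAt v := by
  apply isMinimalAt_baseChange_int_of_not_pow_dvd_Δ
  rw [tw_Δ]
  set p := Rat.HeightOneSpectrum.natGenerator v with hp
  have hpp : p.Prime := Rat.HeightOneSpectrum.prime_natGenerator v
  intro hdvd
  have hdvd' : p ^ 12 ∣ 368 * d ^ 6 := by
    have e : -(-368 * (d : ℤ) ^ 6) = ((368 * d ^ 6 : ℕ) : ℤ) := by push_cast; ring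
    have : ((p : ℤ) ^ 12) ∣ ((368 * d ^ 6 : ℕ) : ℤ) := by
      rw [← dvd_neg, e] at hdvd; exact hdvd
    exact_mod_cast this
  by_cases hpd : p = d
  · -- `d¹² ∣ 368 d⁶ ⇒ d⁶ ∣ 368 ⇒ d ≤ 2`
    subst hpd
    have h6 : p ^ 6 ∣ 368 := by
      have : p ^ 12 = p ^ 6 * p ^ 6 := by ring
      rw [this, mul_comm 368] at hdvd'
      exact (Nat.mul_dvd_mul_iff_left (by positivity)).mp hdvd' 
    have : p ^ 6 ≤ 368 := Nat.le_of_dvd (by norm_num) h6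
    have h36 : 3 ^ 6 ≤ p ^ 6 := Nat.pow_le_pow_left h3 6
    norm_num at h36
    omega
  · -- `p ≠ d`: `p¹²` is coprime to `d⁶`, so `p¹² ∣ 368`, impossible
    have hcop : Nat.Coprime (p ^ 12) (d ^ 6) :=
      Nat.Coprime.pow _ _ ((Nat.coprime_primes hpp hd).mpr hpd)
    have h368 : p ^ 12 ∣ 368 := hcop.dvd_of_dvd_mul_right hdvd'
    have hle : p ^ 12 ≤ 368 := Nat.le_of_dvd (by norm_num) h368
    have h2 : 2 ^ 12 ≤ p ^ 12 := Nat.pow_le_pow_left hpp.two_le 12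
    norm_num at h2
    omega

/-- Radical bounds: `d ≤ N♭ (tw d) ≤ 368 d` for prime `d`. -/
theorem radN_tw_le {d : ℕ} (hd : d.Prime) : radN (tw d) ≤ 368 * d := by
  unfold radN
  rw [tw_Δ_natAbs]
  have h1 : UniqueFactorizationMonoid.radical (368 * d ^ 6) ∣
      UniqueFactorizationMonoid.radical 368 * UniqueFactorizationMonoid.radical (d ^ 6) :=
    UniqueFactorizationMonoid.radical_mul_dvd
  have h2 : UniqueFactorizationMonoid.radical (d ^ 6) = d := by
    rw [UniqueFactorizationMonoid.radical_pow _ (by norm_num),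
      UniqueFactorizationMonoid.radical_of_prime (Nat.prime_iff.mp hd)]
    simp
  have h3 : UniqueFactorizationMonoid.radical (368 : ℕ) ≤ 368 :=
    Nat.radical_le_self_iff.mpr (by norm_num)
  calc UniqueFactorizationMonoid.radical (368 * d ^ 6)
      ≤ UniqueFactorizationMonoid.radical 368 * UniqueFactorizationMonoid.radical (d ^ 6) :=
        Nat.le_of_dvd (by rw [h2]; exact Nat.mul_pos (Nat.radical_pos _) hd.pos) h1
    _ ≤ 368 * d := by rw [h2]; exact Nat.mul_le_mul_right _ h3

theorem le_radN_tw {d : ℕ} (hd : d.Prime) : d ≤ radN (tw d) := by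
  unfold radN
  rw [tw_Δ_natAbs]
  have h : UniqueFactorizationMonoid.radical d ∣ UniqueFactorizationMonoid.radical (368 * d ^ 6) :=
    UniqueFactorizationMonoid.radical_dvd_radical
      (Dvd.intro_left (368 * d ^ 5) (by ring)) (mul_ne_zero (by norm_num) (pow_ne_zero _ hd.ne_zero))
  rw [UniqueFactorizationMonoid.radical_of_prime (Nat.prime_iff.mp hd)] at h
  simp only [normalize_eq] at h
  exact Nat.le_of_dvd (Nat.radical_pos _) h

/-- Membership: for prime `d ≥ 409` and `368 d ≤ X`, `tw d ∈ windowRad 4 23 X`. -/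
theorem tw_mem_windowRad {d : ℕ} (hd : d.Prime) (h409 : 409 ≤ d) {X : ℝ} (hX : 368 * (d : ℝ) ≤ X) :
    tw d ∈ windowRad 4 23 X := by
  haveI : NeZero d := ⟨hd.ne_zero⟩
  have h23 : d ≠ 23 := by omega
  have hlo := le_radN_tw hd
  have hhi := radN_tw_le hd
  have hloR : (d : ℝ) ≤ (radN (tw d) : ℝ) := by exact_mod_cast hlo
  have hhiR : (radN (tw d) : ℝ) ≤ 368 * (d : ℝ) := by exact_mod_cast hhi
  have hd0 : (0 : ℝ) < d := by exact_mod_cast hd.pos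
  have hd409 : (409 : ℝ) ≤ d := by exact_mod_cast h409
  refine ⟨inferInstance, tw_isMinimalAt hd (by omega) h23, Or.inl rfl, Or.inl rfl, Or.inr (Or.inl rfl),
    ?_, ?_, hhiR.trans hX, ?_, ?_⟩
  · rw [tw_c₄]; exact mul_ne_zero (by norm_num) (pow_ne_zero _ (by exact_mod_cast hd.ne_zero))
  · rw [tw_c₆]; exact mul_ne_zero (by norm_num) (pow_ne_zero _ (by exact_mod_cast hd.ne_zero))
  · -- `N♭⁴ ≤ (368 d)⁴ ≤ 110592 d⁶`
    rw [tw_maxInv, show (4 : ℝ) = ((4 : ℕ) : ℝ) by norm_num, Real.rpow_natCast]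
    push_cast
    calc ((radN (tw d) : ℕ) : ℝ) ^ 4 ≤ (368 * (d : ℝ)) ^ 4 :=
          pow_le_pow_left₀ (by positivity) hhiR 4
      _ = 368 ^ 4 * ((d : ℝ) ^ 2 * (d : ℝ) ^ 2) := by ring
      _ ≤ 110592 * 409 ^ 2 * ((d : ℝ) ^ 2 * (d : ℝ) ^ 2) := by
          apply mul_le_mul_of_nonneg_right (by norm_num) (by positivity)
      _ ≤ 110592 * (d : ℝ) ^ 2 * ((d : ℝ) ^ 2 * (d : ℝ) ^ 2) := by
          apply mul_le_mul_of_nonneg_right _ (by positivity)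
          apply mul_le_mul_of_nonneg_left _ (by norm_num)
          exact pow_le_pow_left₀ (by norm_num) hd409 2
      _ = 110592 * (d : ℝ) ^ 6 := by ring
  · -- `110592 d⁶ ≤ d²³ ≤ N♭²³`
    rw [tw_maxInv, show (23 : ℝ) = ((23 : ℕ) : ℝ) by norm_num, Real.rpow_natCast]
    push_cast
    calc (110592 : ℝ) * (d : ℝ) ^ 6 ≤ (d : ℝ) ^ 17 * (d : ℝ) ^ 6 := by
          apply mul_le_mul_of_nonneg_right _ (by positivity)
          calc (110592 : ℝ) ≤ 409 ^ 17 := by norm_num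
            _ ≤ (d : ℝ) ^ 17 := pow_le_pow_left₀ (by norm_num) hd409 17
      _ = (d : ℝ) ^ 23 := by ring
      _ ≤ ((radN (tw d) : ℕ) : ℝ) ^ 23 := pow_le_pow_left₀ hd0.le hloR 23

theorem tw_injective : Function.Injective tw := by
  intro d d' h
  have h6 : (tw d).a₆ = (tw d').a₆ := by rw [h]
  simp only [tw_a₆] at h6
  have h6' : d ^ 3 = d' ^ 3 := by exact_mod_cast h6
  exact Nat.pow_left_injective (by norm_num) h6'

/-! ### 2.2 Counting the prime twists and the Chebyshev endgame -/

/-- The twisting primes `408 < d ≤ T`. -/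
def twPrimes (T : ℕ) : Finset ℕ := (Finset.Ioc 408 T).filter Nat.Prime

theorem card_twPrimes_le_ncard (T : ℕ) :
    ((twPrimes T).card : ℝ) ≤ (Set.ncard (windowRad 4 23 (368 * T)) : ℝ) := by
  classical
  have hsub : (↑((twPrimes T).image tw) : Set (WeierstrassCurve ℤ)) ⊆ windowRad 4 23 (368 * T) := by
    intro W hW
    rw [Finset.coe_image] at hW
    obtain ⟨d, hd, rfl⟩ := hW
    rw [Finset.mem_coe, twPrimes, Finset.mem_filter, Finset.mem_Ioc] at hd
    obtain ⟨⟨h408, hdT⟩, hp⟩ := hd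
    exact tw_mem_windowRad hp (by omega) (by exact_mod_cast Nat.mul_le_mul_left 368 hdT)
  have h1 : (twPrimes T).card = ((twPrimes T).image tw).card :=
    (Finset.card_image_of_injective _ tw_injective).symm
  have h2 : ((twPrimes T).image tw).card =
      Set.ncard (↑((twPrimes T).image tw) : Set (WeierstrassCurve ℤ)) :=
    (Set.ncard_coe_finset _).symm
  have h3 := Set.ncard_le_ncard hsub (windowRad_finite _ _ _)
  exact_mod_cast (h1.trans h2).le.trans h3

open Chebyshev in
theorem theta_split {T : ℕ} (hT : 408 ≤ T) :
    θ (T : ℝ) = θ ((408 : ℕ) : ℝ) + ∑ p ∈ twPrimes T, Real.log p := by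
  rw [theta_eq_sum_primesLE_log T, theta_eq_sum_primesLE_log 408]
  have hU : Nat.primesLE T = Nat.primesLE 408 ∪ twPrimes T := by
    ext p
    simp only [Nat.mem_primesLE, twPrimes, Finset.mem_union, Finset.mem_filter, Finset.mem_Ioc]
    constructor
    · rintro ⟨hpT, hp⟩
      by_cases h : p ≤ 408
      · exact Or.inl ⟨h, hp⟩
      · exact Or.inr ⟨⟨by omega, hpT⟩, hp⟩
    · rintro (⟨h, hp⟩ | ⟨⟨-, h⟩, hp⟩)
      · exact ⟨h.trans hT, hp⟩
      · exact ⟨h, hp⟩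
  have hD : Disjoint (Nat.primesLE 408) (twPrimes T) := by
    rw [Finset.disjoint_left]
    intro p hp hp'
    rw [Nat.mem_primesLE] at hp
    rw [twPrimes, Finset.mem_filter, Finset.mem_Ioc] at hp'
    omega
  rw [hU, Finset.sum_union hD]

theorem sum_log_twPrimes_le (T : ℕ) :
    ∑ p ∈ twPrimes T, Real.log p ≤ (twPrimes T).card * Real.log T := by
  have h : ∀ p ∈ twPrimes T, Real.log p ≤ Real.log T := by
    intro p hp
    rw [twPrimes, Finset.mem_filter, Finset.mem_Ioc] at hp
    exact Real.log_le_log (by exact_mod_cast hp.2.pos) (by exact_mod_cast hp.1.2)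
  calc ∑ p ∈ twPrimes T, Real.log p ≤ ∑ _p ∈ twPrimes T, Real.log T := Finset.sum_le_sum h
    _ = (twPrimes T).card * Real.log T := by rw [Finset.sum_const, nsmul_eq_mul]

open Chebyshev in
/-- **Prime supply** (Chebyshev, via `Literature.Barriers.ABC.eventually_theta_ge_half` and Mathlib's
`Chebyshev.theta_le_log4_mul_x`): eventually `T/4 ≤ #{408 < p ≤ T} · log T`. -/
theorem twPrimes_card_mul_log_ge :
    ∃ T₁ : ℕ, ∀ T : ℕ, T₁ ≤ T → (T : ℝ) / 4 ≤ (twPrimes T).card * Real.log T := by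
  obtain ⟨T₀, hT₀⟩ := Literature.Barriers.ABC.eventually_theta_ge_half
  refine ⟨max T₀ 2300, fun T hT => ?_⟩
  have hT0 : T₀ ≤ T := le_of_max_le_left hT
  have hT2300 : 2300 ≤ T := le_of_max_le_right hT
  have h1 := hT₀ T hT0
  have h2 := theta_split (T := T) (by omega)
  have h3 := sum_log_twPrimes_le T
  have h4 : θ ((408 : ℕ) : ℝ) ≤ Real.log 4 * ((408 : ℕ) : ℝ) := theta_le_log4_mul_x (by positivity)
  have hlog4 : Real.log 4 < 1.3863 := by
    have : Real.log 4 = 2 * Real.log 2 := by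
      rw [show (4 : ℝ) = 2 ^ 2 by norm_num, Real.log_pow]; norm_num
    rw [this]
    have := Real.log_two_lt_d9
    linarith
  have hT' : (2300 : ℝ) ≤ T := by exact_mod_cast hT2300
  push_cast at h2 h4
  have h5 : ↑T / 2 - 1.3863 * 408 ≤ ((twPrimes T).card : ℝ) * Real.log T := by
    have : Real.log 4 * 408 ≤ 1.3863 * 408 := by linarith
    linarith
  linarith

/-- **The radical proxy is FALSE**: `¬ SharpModerateLawRadical` (prime twists of one curve;
`κ = 4`, `σ = 23`, `ε = 1/6`, `X = 368 m⁸`). Hence any proof of the crux must use the conductor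
exponent `f_p = 2` at the additive primes of twists, and any transfer statement built on `rad Δ`
(or on `rad` of a discriminant form) instead of `N` is refuted by the same family. -/
theorem not_sharpModerateLawRadical : ¬ SharpModerateLawRadical := by
  intro h
  obtain ⟨C, hC⟩ := h 4 23 (1 / 6) (by norm_num) (by norm_num) (by norm_num) (by norm_num)
  obtain ⟨T₁, hT₁⟩ := twPrimes_card_mul_log_ge
  -- the parameter
  set m : ℕ := T₁ + 640 * ⌈C⌉₊ + 2 with hm
  have hm2 : (2 : ℝ) ≤ m := by
    have : 2 ≤ m := by omega
    exact_mod_cast this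
  have hm0 : (0 : ℝ) < m := by linarith
  have hmC : 640 * C < m := by
    have h1 : C ≤ ⌈C⌉₊ := Nat.le_ceil C
    have h2 : ((T₁ + 640 * ⌈C⌉₊ + 2 : ℕ) : ℝ) = m := by rw [hm]
    push_cast at h2
    have : (0 : ℝ) ≤ T₁ := by positivity
    linarith
  have hT₁m : T₁ ≤ m ^ 8 := by
    calc T₁ ≤ m := by omega
      _ = m ^ 1 := (pow_one m).symm
      _ ≤ m ^ 8 := Nat.pow_le_pow_right (by omega) (by norm_num)
  clear_value m
  -- supply at `T = m⁸`
  have hsup := hT₁ (m ^ 8) hT₁m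
  push_cast at hsup
  rw [Real.log_pow] at hsup
  have hlogm : Real.log m ≤ m := by
    have := Real.log_le_sub_one_of_pos hm0; linarith
  -- the law at `X = 368 m⁸`
  have hX1 : (1 : ℝ) ≤ 368 * (m : ℝ) ^ 8 := by
    have : (1 : ℝ) ≤ (m : ℝ) ^ 8 := one_le_pow₀ (by linarith)
    linarith
  have hlaw := hC (368 * (m : ℝ) ^ 8) hX1
  have hcount := card_twPrimes_le_ncard (m ^ 8)
  push_cast at hcount
  -- simplify the power `(368 m⁸)^(1 − 4/6 + 1/6) ≤ 20 m⁴`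
  have hexp : (368 * (m : ℝ) ^ 8) ^ (1 - 4 / 6 + 1 / 6 : ℝ) ≤ 20 * (m : ℝ) ^ 4 := by
    rw [show (1 - 4 / 6 + 1 / 6 : ℝ) = 1 / 2 by norm_num,
      Real.mul_rpow (by norm_num) (by positivity)]
    have e1 : ((m : ℝ) ^ 8) ^ (1 / 2 : ℝ) = (m : ℝ) ^ 4 := by
      rw [← Real.rpow_natCast (m : ℝ) 8, ← Real.rpow_mul hm0.le]
      rw [show ((8 : ℕ) : ℝ) * (1 / 2) = ((4 : ℕ) : ℝ) by norm_num, Real.rpow_natCast]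
    have e2 : (368 : ℝ) ^ (1 / 2 : ℝ) ≤ 20 := by
      have : (20 : ℝ) = (400 : ℝ) ^ (1 / 2 : ℝ) := by
        rw [show (400 : ℝ) = 20 ^ 2 by norm_num, ← Real.rpow_natCast 20 2, ← Real.rpow_mul (by norm_num)]
        norm_num
      rw [this]
      exact Real.rpow_le_rpow (by norm_num) (by norm_num) (by norm_num)
    rw [e1]
    exact mul_le_mul_of_nonneg_right e2 (by positivity)
  -- card ≥ 0 forces `C ≥ 0`-type information; combine everything
  have hcard0 : (0 : ℝ) ≤ (twPrimes (m ^ 8)).card := Nat.cast_nonneg _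
  have hm8 : (0 : ℝ) < (m : ℝ) ^ 8 := by positivity
  -- from the supply: `m⁸/4 ≤ card · 8 log m ≤ 8 m · card`
  have hA : (m : ℝ) ^ 8 / 4 ≤ 8 * m * (twPrimes (m ^ 8)).card := by
    calc (m : ℝ) ^ 8 / 4 ≤ (twPrimes (m ^ 8)).card * (8 * Real.log m) := hsup
      _ ≤ (twPrimes (m ^ 8)).card * (8 * m) := by
          apply mul_le_mul_of_nonneg_left _ hcard0; linarith
      _ = 8 * m * (twPrimes (m ^ 8)).card := by ring
  -- from the law: `card ≤ C · 20 m⁴`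
  rcases lt_or_ge C 0 with hC0 | hC0
  · have : C * (368 * (m : ℝ) ^ 8) ^ (1 - 4 / 6 + 1 / 6 : ℝ) < 0 :=
      mul_neg_of_neg_of_pos hC0 (Real.rpow_pos_of_pos (by positivity) _)
    linarith
  have hB : ((twPrimes (m ^ 8)).card : ℝ) ≤ C * (20 * (m : ℝ) ^ 4) :=
    (hcount.trans hlaw).trans (mul_le_mul_of_nonneg_left hexp hC0)
  -- so `m⁸ / 4 ≤ 8 m · 20 C m⁴ = 160 C m⁵`, i.e. `m³ ≤ 640 C < m`, absurd for `m ≥ 2`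
  have hD : (m : ℝ) ^ 8 / 4 ≤ 160 * C * (m : ℝ) ^ 5 := by
    calc (m : ℝ) ^ 8 / 4 ≤ 8 * m * (twPrimes (m ^ 8)).card := hA
      _ ≤ 8 * m * (C * (20 * (m : ℝ) ^ 4)) := mul_le_mul_of_nonneg_left hB (by positivity)
      _ = 160 * C * (m : ℝ) ^ 5 := by ring
  have hm5 : (0 : ℝ) < (m : ℝ) ^ 5 := by positivity
  have hE : (m : ℝ) ^ 3 ≤ 640 * C := by
    have : (m : ℝ) ^ 8 / 4 = ((m : ℝ) ^ 3 / 4) * (m : ℝ) ^ 5 := by ring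
    rw [this] at hD
    have := le_of_mul_le_mul_right (by linarith : (m : ℝ) ^ 3 / 4 * (m : ℝ) ^ 5 ≤ 160 * C * (m : ℝ) ^ 5) hm5
    linarith
  have hF : (m : ℝ) ≤ (m : ℝ) ^ 3 := by
    calc (m : ℝ) = (m : ℝ) ^ 1 := (pow_one _).symm
      _ ≤ (m : ℝ) ^ 3 := pow_le_pow_right₀ (by linarith) (by norm_num)
  linarith

/-! ## 3. `κ < 6` is load-bearing (re-certified): one curve of ratio `8.54` kills the κ-unbounded form

The reduced minimal model `W30 : y² + xy + y = x³ − 334x − 2368` (Frey curve of `3 + 5³ = 2⁷`;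
Cremona 30a) has `c₄ = 16009 = 7·2287`, `c₆ = 2021723`, `Δ = 9000000 = 2⁶3²5⁶`, conductor EXACTLY `30`
(certified below from Tate/Ogg via `SzpiroLocalDataProofs`: `f_p = 1` at `p = 2,3,5`, `0` elsewhere) and
`M⁺ = 16009³ = 30^{8.54…}`. With `κ < 6` dropped take `κ = 7`, `σ = 9`, `ε = 1/12`: the exponent
`1 − κ/6 + ε = −1/12` is negative while `T_[7,9](X) ≥ 1` for all `X ≥ 30`. This section is also the
TEMPLATE for certifying the exact conductor of an explicit integral model in this tree. -/

/-- Cremona 30a-class curve `y² + xy + y = x³ − 334 x − 2368` (reduced: `a₁ = 1, a₂ = 0, a₃ = 1`). -/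
def W30 : WeierstrassCurve ℤ := ⟨1, 0, 1, -334, -2368⟩

theorem W30_c₄ : W30.c₄ = 16009 := by
  norm_num [W30, WeierstrassCurve.c₄, WeierstrassCurve.b₂, WeierstrassCurve.b₄]

theorem W30_c₆ : W30.c₆ = 2021723 := by
  norm_num [W30, WeierstrassCurve.c₆, WeierstrassCurve.b₂, WeierstrassCurve.b₄, WeierstrassCurve.b₆]

theorem W30_Δ : W30.Δ = 9000000 := by
  norm_num [W30, WeierstrassCurve.Δ, WeierstrassCurve.b₂, WeierstrassCurve.b₄, WeierstrassCurve.b₆,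
    WeierstrassCurve.b₈]

instance W30_isElliptic : (W30.baseChange ℚ).IsElliptic :=
  ⟨by rw [baseChange_int_Δ, W30_Δ, isUnit_iff_ne_zero]; norm_num⟩

/-- `p¹² ∤ 9000000` for every prime `p`, so `W30` is minimal at every place. -/
theorem W30_isMinimalAt (v : HeightOneSpectrum ℤ) : (W30.baseChange ℚ).IsMinimalAt v := by
  apply isMinimalAt_baseChange_int_of_not_pow_dvd_Δ
  rw [W30_Δ]
  set p := Rat.HeightOneSpectrum.natGenerator v with hp
  have hpp : p.Prime := Rat.HeightOneSpectrum.prime_natGenerator v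
  intro hdvd
  have hdvd' : p ^ 12 ∣ 9000000 := by exact_mod_cast hdvd
  have hle : p ^ 12 ≤ 9000000 := Nat.le_of_dvd (by norm_num) hdvd'
  have hp4 : p < 4 := by
    by_contra h
    have : 4 ^ 12 ≤ p ^ 12 := Nat.pow_le_pow_left (by omega) 12
    norm_num at this
    omega
  have h2 := hpp.two_le
  interval_cases p
  · norm_num at hdvd'
  · norm_num at hdvd'

/-- The primes of `Δ(W30) = 2⁶3²5⁶` are `2, 3, 5`. -/
theorem W30_prime_dvd_Δ_iff {p : ℕ} (hp : p.Prime) : (p : ℤ) ∣ W30.Δ ↔ p = 2 ∨ p = 3 ∨ p = 5 := by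
  rw [W30_Δ]
  constructor
  · intro h
    have h' : p ∣ 2 ^ 6 * 3 ^ 2 * 5 ^ 6 := by
      have : p ∣ 9000000 := by exact_mod_cast h
      simpa using this
    rcases (Nat.Prime.dvd_mul hp).mp h' with h | h
    · rcases (Nat.Prime.dvd_mul hp).mp h with h | h
      · exact Or.inl ((Nat.prime_dvd_prime_iff_eq hp Nat.prime_two).mp (hp.dvd_of_dvd_pow h))
      · exact Or.inr (Or.inl ((Nat.prime_dvd_prime_iff_eq hp Nat.prime_three).mp (hp.dvd_of_dvd_pow h)))
    · exact Or.inr (Or.inr ((Nat.prime_dvd_prime_iff_eq hp Nat.prime_five).mp (hp.dvd_of_dvd_pow h)))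
  · rintro (rfl | rfl | rfl) <;> norm_num

/-- Local conductor exponents of `W30`: `f_p = 1` for `p ∈ {2,3,5}` (multiplicative: `p ∣ Δ`, `p ∤ c₄`),
`f_p = 0` otherwise. -/
theorem W30_conductorExponent (p : Nat.Primes) :
    (W30.baseChange ℚ).conductorExponent ((Rat.HeightOneSpectrum.primesEquiv (R := ℤ)).symm p) =
      if (p : ℕ) = 2 ∨ (p : ℕ) = 3 ∨ (p : ℕ) = 5 then 1 else 0 := by
  set v := (Rat.HeightOneSpectrum.primesEquiv (R := ℤ)).symm p with hv
  have hgen : Rat.HeightOneSpectrum.natGenerator v = p :=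
    Literature.NumberTheory.EllipticCurves.Rat.natGenerator_primesEquiv_symm p
  have hp : (p : ℕ).Prime := p.2
  split_ifs with h
  · apply conductorExponent_eq_one_of_dvd_Δ_of_not_dvd_c₄ (W30_isMinimalAt v)
    · rw [hgen]; exact (W30_prime_dvd_Δ_iff hp).mpr h
    · rw [hgen, W30_c₄]
      intro hd
      have hd' : (p : ℕ) ∣ 16009 := by exact_mod_cast hd
      rcases h with h | h | h <;> rw [h] at hd' <;> norm_num at hd'
  · apply conductorExponent_eq_zero_of_not_dvd_Δ (W30_isMinimalAt v)
    rw [hgen]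
    exact fun hd => h ((W30_prime_dvd_Δ_iff hp).mp hd)

/-- **The conductor of `W30` is exactly `30`.** -/
theorem W30_conductorNorm : (W30.baseChange ℚ).conductorNorm ℤ = 30 := by
  have hdvd : (W30.baseChange ℚ).conductorNorm ℤ ∣ 30 := by
    apply conductorNorm_dvd_of_forall_conductorExponent_le _ (by norm_num)
    intro p
    rw [W30_conductorExponent]
    split_ifs with h
    · refine (Nat.Prime.dvd_iff_one_le_factorization p.2 (by norm_num)).mp ?_
      rcases h with h | h | h <;> rw [h] <;> norm_num
    · exact Nat.zero_le _
  have hfac : ∀ q : Nat.Primes, ((q : ℕ) = 2 ∨ (q : ℕ) = 3 ∨ (q : ℕ) = 5) →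
      (q : ℕ) ∣ (W30.baseChange ℚ).conductorNorm ℤ := by
    intro q hq
    apply Nat.dvd_of_factorization_pos
    rw [factorization_conductorNorm_primesEquiv_symm, W30_conductorExponent, if_pos hq]
    exact one_ne_zero
  have h2 := hfac ⟨2, Nat.prime_two⟩ (Or.inl rfl)
  have h3 := hfac ⟨3, Nat.prime_three⟩ (Or.inr (Or.inl rfl))
  have h5 := hfac ⟨5, Nat.prime_five⟩ (Or.inr (Or.inr rfl))
  have h30 : 30 ∣ (W30.baseChange ℚ).conductorNorm ℤ := by
    have h6 : 6 ∣ (W30.baseChange ℚ).conductorNorm ℤ :=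
      Nat.Coprime.mul_dvd_of_dvd_of_dvd (by norm_num) h2 h3
    exact Nat.Coprime.mul_dvd_of_dvd_of_dvd (by norm_num) h6 h5
  exact Nat.dvd_antisymm hdvd h30

theorem W30_maxInv : max |W30.Δ| (|W30.c₄| ^ 3) = 16009 ^ 3 := by
  rw [W30_Δ, W30_c₄]; norm_num

/-- `W30` lies in every window `[7, 9]` at scale `X ≥ 30` (`30⁷ ≤ 16009³ ≤ 30⁹`). -/
theorem W30_mem_window {X : ℝ} (hX : 30 ≤ X) : W30 ∈ window 7 9 X := by
  refine ⟨inferInstance, W30_isMinimalAt, Or.inr rfl, Or.inr rfl, Or.inr (Or.inl rfl), ?_, ?_, ?_, ?_, ?_⟩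
  · rw [W30_c₄]; norm_num
  · rw [W30_c₆]; norm_num
  · rw [W30_conductorNorm]; exact_mod_cast hX
  · rw [W30_conductorNorm, W30_maxInv, show (7 : ℝ) = ((7 : ℕ) : ℝ) by norm_num, Real.rpow_natCast]
    norm_num
  · rw [W30_conductorNorm, W30_maxInv, show (9 : ℝ) = ((9 : ℕ) : ℝ) by norm_num, Real.rpow_natCast]
    norm_num

theorem one_le_T_seven_nine {X : ℝ} (hX : 30 ≤ X) : 1 ≤ T 7 9 X :=
  (Set.ncard_pos (window_finite _ _ _)).mpr ⟨W30, W30_mem_window hX⟩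

/-- The crux with the clause `κ < 6` dropped. -/
def SharpModerateLawWithoutKappaLtSix : Prop :=
  ∀ κ σ ε : ℝ, 3 < κ → 6 < σ → 0 < ε →
    ∃ C : ℝ, ∀ X : ℝ, 1 ≤ X → (T κ σ X : ℝ) ≤ C * X ^ (1 - κ / 6 + ε)

/-- **`κ < 6` is load-bearing**: without it the statement is false (`κ = 7`, `σ = 9`, `ε = 1/12`:
negative exponent against the single curve `W30`). -/
theorem not_sharpModerateLawWithoutKappaLtSix : ¬ SharpModerateLawWithoutKappaLtSix := by
  intro h
  obtain ⟨C, hC⟩ := h 7 9 (1 / 12) (by norm_num) (by norm_num) (by norm_num)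
  set Y : ℝ := max 30 (C + 1) with hY
  have hY30 : (30 : ℝ) ≤ Y := le_max_left _ _
  have hYC : C + 1 ≤ Y := le_max_right _ _
  have hY0 : (0 : ℝ) < Y := by linarith
  have hX : (30 : ℝ) ≤ Y ^ 12 := by
    calc (30 : ℝ) ≤ Y := hY30
      _ = Y ^ 1 := (pow_one Y).symm
      _ ≤ Y ^ 12 := pow_le_pow_right₀ (by linarith) (by norm_num)
  have h1 := hC (Y ^ 12) (by linarith)
  have h2 : (1 : ℝ) ≤ T 7 9 (Y ^ 12) := by exact_mod_cast one_le_T_seven_nine hX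
  have hexp : (Y ^ 12) ^ (1 - 7 / 6 + 1 / 12 : ℝ) = Y⁻¹ := by
    rw [show (1 - 7 / 6 + 1 / 12 : ℝ) = -1 / 12 by norm_num, ← Real.rpow_natCast Y 12,
      ← Real.rpow_mul hY0.le, show ((12 : ℕ) : ℝ) * (-1 / 12) = -1 by norm_num, Real.rpow_neg_one]
  rw [hexp] at h1
  have h3 : (1 : ℝ) ≤ C * Y⁻¹ := h2.trans h1
  rw [← div_eq_mul_inv, le_div_iff₀ hY0] at h3
  linarith

/-! ## 4. Frontier of the algebraic attack (why no polynomial family has killed the crux)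

Bookkeeping (F1). A polynomial family `(c₄, c₆) = (F, G)` — forms of degrees `2w', 3w'` in `k+1`
variables, `Δ̃ := F³ − G² = ∏ H_i^{m_i}` — contributes, from the parameters of height `≤ H`,
`H^{c}` distinct curves (`c ≤ k+1`; `c < k+1` when the values `(F(a), G(a))` crowd) of conductor
`≲ H^{r}`, `r := Σ δ_i deg H_i` (`δ = 1` multiplicative, `2` additive) and `M⁺ ≈ H^{6w'}`; so it puts
`X^{c/r}` curves at ratio `6w'/r` into the window, against the law `X^{1 − w'/r}`:
**LAW ⟺ c ≤ r − w'**, and `r − w' − 2 = R + A` where `R` is the number of NON-forced critical points of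
`j = 1728 F³/Δ̃` on a generic line (= the degree of the foliation of a generic plane by level curves of
`j`) and `A` the additive degree. Szpiro–Shioda on the generic line is `R + A ≥ 0`; the law needs
`R + A ≥ c − 2`.

No-go (F2, this cycle; paper proofs in NOTES.md §F2):
* `R = 0` ⟹ the reduced gradient field `γ̃ = (3G∇F − 2F∇G)/∏H_i^{m_i−1}` is linear with `p·γ̃ = 0`,
  so `γ̃ = ω × p` and `j` is composed with the pencil of lines through `ω` (`c ≤ 2`).
* `R = 1` ⟹ `γ̃ = p × Λp`; level curves are `exp(tΛ)`-orbits, so `j` is composite with a binomial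
  pencil `⟨x^a y^b, z^{a+b}⟩` or a bitangent conic pencil `⟨ℓ², Q⟩`; `deg ρ = 1` is excluded by the
  fibre shape `3D₀ + 2D₁` (it would force `r = 6w'`). Both pencils have `c ≤ 3 = R + 2` in every
  dimension (values `(x^a y^b, z^{a+b})`, `(ℓ², Q)` of a height-`H` box number `≪ H³`).
* composite `j = ρ ∘ ψ`: `r ≥ e(w_ρ + s_ρ) + 2 + R_ψ` (Mason–Stothers for `ρ`, R–H for `ψ`), hence
  `c ≤ R_ψ + 2 ≤ r − w'` whenever `R_ψ ≤ 1`.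
Consequently every family with `c ≤ 3` (in particular every family in `≤ 3` parameters) is on/below
the law, with equality exactly for: Belyi-extremal P¹-families, their power/product specialisations
`t = (u^a : v^b)` and weighted pullbacks, quadratic twists along them, and Hensel unfoldings such as
`henselFamily` below (F3).

What a kill needs (sharpened): a pencil with `c ≥ R + 3`, i.e. a counterexample to
**Conjecture V** — *the values of a pencil `ψ = (U : V)` of forms on `ℤ^{k+1} ∩ [−H, H]^{k+1}` number
`≪ H^{R_ψ + 2 + o(1)}`* — realised by `ψ = (F³ : G²)` with `w' = ` (degree)` large enough for the window
(`6w'/r > 3`). Conjecture V is the random-model expectation (each further non-reduced member `W` of the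
pencil is an event of probability `H^{r_W − e}` on the value pairs) and holds for `R_ψ ≤ 1` by the
classification above; the first open case is `R = 2`, e.g. a non-composite `(F, G)` in `≥ 5` essential
variables with `r = w' + 4`. For `w' = 1` the general solution of `ℓ² ∣ F³ − G²` is the 4-form Hensel
family below (`c ≤ 4 = R + 2`: on the law in every dimension), so `w' = 1` cannot do it. -/

/-- **Hensel unfolding of Davenport's pair** (`w' = 1`, `R = 2`, non-composite, 4 essential linear
parameters `φ ℓ M N`): `(φ² + 2ℓM)³ − (φ³ + 3φℓM + ℓ²N)² = ℓ² · R₄`. Its specialisations: `N = 0` is the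
composite `R = 1` family `(t² + 2sz, t³ + 3tsz)` with `Δ̃ = s²z²(3t² + 8sz)` (exactly on the law at
ratio `3/2`); `ℓ = y², M = 1, N = 0, φ = x` is Davenport's `(x²+2)³ − (x³+3x)² = 3x² + 8`. As a
P³-family it has `r = 5 = w' + k + 1`: exactly ON the law (ratio `6/5`, outside the window) — the
first non-composite on-the-law family recorded for this crux. -/
theorem henselFamily_identity {R : Type*} [CommRing R] (φ ℓ M N : R) :
    (φ ^ 2 + 2 * ℓ * M) ^ 3 - (φ ^ 3 + 3 * φ * ℓ * M + ℓ ^ 2 * N) ^ 2 =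
      ℓ ^ 2 * (3 * φ ^ 2 * M ^ 2 - 2 * φ ^ 3 * N + 8 * ℓ * M ^ 3 - 6 * φ * ℓ * M * N - ℓ ^ 2 * N ^ 2) := by
  ring

/-- The composite `R = 1` specialisation used in F3: `(t² + 2sz)³ − (t³ + 3tsz)² = s² z² (3t² + 8sz)`. -/
theorem weightedPullback_identity {R : Type*} [CommRing R] (t s z : R) :
    (t ^ 2 + 2 * s * z) ^ 3 - (t ^ 3 + 3 * t * s * z) ^ 2 = s ^ 2 * z ^ 2 * (3 * t ^ 2 + 8 * s * z) := by
  ring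

/-- Euler orthogonality behind the foliation count: for the gradient-type field of `j = F³/G²`,
`p · (3G∇F − 2F∇G) = 3G·(2w'F) − 2F·(3w'G) = 0`. Recorded as the scalar identity it reduces to. -/
theorem euler_orthogonality {R : Type*} [CommRing R] (w F G : R) :
    3 * G * (2 * w * F) - 2 * F * (3 * w * G) = 0 := by
  ring

/-! ## 5. `c₄ ≠ 0` is load-bearing (re-certified; triage BUG 1): sextic twists of `j = 0`

Dropping ONLY the clause `c₄ ≠ 0` admits the CM family `cm b : y² = x³ + b⁵` (`b ≥ 5` prime): reduced,
minimal (`Δ = −432 b¹⁰`), `c₄ = 0`, `c₆ = −864 b⁵ ≠ 0`, additive at `b` with `f_b = 2` exactly, so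
`b² ≤ N ≤ 432 b²` while `M⁺ = 432 b¹⁰`: ratio `→ 5`. At `κ = 4`, `σ = 7`, `ε = 1/12` the `≍ X^{1/2}/log X`
members (`432 b² ≤ X`) beat `C X^{5/12}`. (j = 0 and 1728 twist families saturate `X^{1/2}` at every ratio
`< 5` resp. `< 9/2`; this is why the route counts only `c₄ c₆ ≠ 0`.) -/

/-- General prime supply in `(A, T]` (Chebyshev): eventually `T/4 ≤ #{A < p ≤ T} · log T`. -/
def primesIoc (A T : ℕ) : Finset ℕ := (Finset.Ioc A T).filter Nat.Prime

open Chebyshev in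
theorem theta_split_gen {A T : ℕ} (hT : A ≤ T) :
    θ (T : ℝ) = θ (A : ℝ) + ∑ p ∈ primesIoc A T, Real.log p := by
  rw [theta_eq_sum_primesLE_log T, theta_eq_sum_primesLE_log A]
  have hU : Nat.primesLE T = Nat.primesLE A ∪ primesIoc A T := by
    ext p
    simp only [Nat.mem_primesLE, primesIoc, Finset.mem_union, Finset.mem_filter, Finset.mem_Ioc]
    constructor
    · rintro ⟨hpT, hp⟩
      by_cases h : p ≤ A
      · exact Or.inl ⟨h, hp⟩
      · exact Or.inr ⟨⟨by omega, hpT⟩, hp⟩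
    · rintro (⟨h, hp⟩ | ⟨⟨-, h⟩, hp⟩)
      · exact ⟨h.trans hT, hp⟩
      · exact ⟨h, hp⟩
  have hD : Disjoint (Nat.primesLE A) (primesIoc A T) := by
    rw [Finset.disjoint_left]
    intro p hp hp'
    rw [Nat.mem_primesLE] at hp
    rw [primesIoc, Finset.mem_filter, Finset.mem_Ioc] at hp'
    omega
  rw [hU, Finset.sum_union hD]

theorem sum_log_primesIoc_le (A T : ℕ) :
    ∑ p ∈ primesIoc A T, Real.log p ≤ (primesIoc A T).card * Real.log T := by
  have h : ∀ p ∈ primesIoc A T, Real.log p ≤ Real.log T := by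
    intro p hp
    rw [primesIoc, Finset.mem_filter, Finset.mem_Ioc] at hp
    exact Real.log_le_log (by exact_mod_cast hp.2.pos) (by exact_mod_cast hp.1.2)
  calc ∑ p ∈ primesIoc A T, Real.log p ≤ ∑ _p ∈ primesIoc A T, Real.log T := Finset.sum_le_sum h
    _ = (primesIoc A T).card * Real.log T := by rw [Finset.sum_const, nsmul_eq_mul]

open Chebyshev in
theorem primesIoc_card_mul_log_ge (A : ℕ) :
    ∃ T₁ : ℕ, ∀ T : ℕ, T₁ ≤ T → (T : ℝ) / 4 ≤ (primesIoc A T).card * Real.log T := by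
  obtain ⟨T₀, hT₀⟩ := Literature.Barriers.ABC.eventually_theta_ge_half
  refine ⟨max T₀ (6 * A + 1), fun T hT => ?_⟩
  have hT0 : T₀ ≤ T := le_of_max_le_left hT
  have hTA : 6 * A + 1 ≤ T := le_of_max_le_right hT
  have h1 := hT₀ T hT0
  have h2 := theta_split_gen (A := A) (T := T) (by omega)
  have h3 := sum_log_primesIoc_le A T
  have h4 : θ (A : ℝ) ≤ Real.log 4 * (A : ℝ) := theta_le_log4_mul_x (by positivity)
  have hlog4 : Real.log 4 < 1.3863 := by
    have : Real.log 4 = 2 * Real.log 2 := by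
      rw [show (4 : ℝ) = 2 ^ 2 by norm_num, Real.log_pow]; norm_num
    rw [this]
    have := Real.log_two_lt_d9
    linarith
  have hT' : 6 * (A : ℝ) + 1 ≤ T := by exact_mod_cast hTA
  have hA0 : (0 : ℝ) ≤ A := by positivity
  have h5 : Real.log 4 * (A : ℝ) ≤ 1.3863 * A := mul_le_mul_of_nonneg_right hlog4.le hA0
  nlinarith

/-! ### 5.1 The CM family -/

/-- `cm b : y² = x³ + b⁵` (`j = 0`). -/
def cm (b : ℕ) : WeierstrassCurve ℤ := ⟨0, 0, 0, 0, (b : ℤ) ^ 5⟩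

theorem cm_c₄ (b : ℕ) : (cm b).c₄ = 0 := by
  simp [cm, WeierstrassCurve.c₄, WeierstrassCurve.b₂, WeierstrassCurve.b₄]

theorem cm_c₆ (b : ℕ) : (cm b).c₆ = -864 * (b : ℤ) ^ 5 := by
  simp only [cm, WeierstrassCurve.c₆, WeierstrassCurve.b₂, WeierstrassCurve.b₄, WeierstrassCurve.b₆]
  ring

theorem cm_Δ (b : ℕ) : (cm b).Δ = -432 * (b : ℤ) ^ 10 := by
  simp only [cm, WeierstrassCurve.Δ, WeierstrassCurve.b₂, WeierstrassCurve.b₄, WeierstrassCurve.b₆,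
    WeierstrassCurve.b₈]
  ring

theorem cm_maxInv (b : ℕ) : max |(cm b).Δ| (|(cm b).c₄| ^ 3) = 432 * (b : ℤ) ^ 10 := by
  rw [cm_Δ, cm_c₄, abs_mul, abs_of_nonpos (by norm_num : (-432 : ℤ) ≤ 0), abs_pow, Nat.abs_cast]
  norm_num

instance cm_isElliptic (b : ℕ) [NeZero b] : ((cm b).baseChange ℚ).IsElliptic := by
  refine ⟨?_⟩
  rw [baseChange_int_Δ, cm_Δ, isUnit_iff_ne_zero]
  have : (b : ℚ) ≠ 0 := by exact_mod_cast NeZero.ne b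
  push_cast
  exact mul_ne_zero (by norm_num) (pow_ne_zero _ this)

/-- Minimality of `cm b` at every place for prime `b ≥ 5` (`v_p(Δ) ≤ 10 < 12`). -/
theorem cm_isMinimalAt {b : ℕ} (hb : b.Prime) (h5 : 5 ≤ b) (v : HeightOneSpectrum ℤ) :
    ((cm b).baseChange ℚ).IsMinimalAt v := by
  apply isMinimalAt_baseChange_int_of_not_pow_dvd_Δ
  rw [cm_Δ]
  set p := Rat.HeightOneSpectrum.natGenerator v with hp
  have hpp : p.Prime := Rat.HeightOneSpectrum.prime_natGenerator v
  intro hdvd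
  have e : -(-432 * (b : ℤ) ^ 10) = ((432 * b ^ 10 : ℕ) : ℤ) := by push_cast; ring
  have hdvd' : p ^ 12 ∣ 432 * b ^ 10 := by
    have : ((p : ℤ) ^ 12) ∣ ((432 * b ^ 10 : ℕ) : ℤ) := by rw [← dvd_neg, e] at hdvd; exact hdvd
    exact_mod_cast this
  by_cases hpb : p = b
  · subst hpb
    have h2 : p ^ 2 ∣ 432 := by
      have : p ^ 12 = p ^ 10 * p ^ 2 := by ring
      rw [this, mul_comm 432] at hdvd'
      exact (Nat.mul_dvd_mul_iff_left (pow_pos hpp.pos 10)).mp hdvd'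
    have : p ^ 2 ≤ 432 := Nat.le_of_dvd (by norm_num) h2
    -- `p ≥ 5` prime with `p² ∣ 432 = 2⁴3³`: impossible
    have hcop2 : Nat.Coprime p 2 := (Nat.coprime_primes hpp Nat.prime_two).mpr (by omega)
    have hcop3 : Nat.Coprime p 3 := (Nat.coprime_primes hpp Nat.prime_three).mpr (by omega)
    have hcop : Nat.Coprime (p ^ 2) 432 := by
      rw [show (432 : ℕ) = 2 ^ 4 * 3 ^ 3 by norm_num]
      exact Nat.Coprime.mul_right (Nat.Coprime.pow _ _ hcop2) (Nat.Coprime.pow _ _ hcop3)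
    have := Nat.Coprime.eq_one_of_dvd hcop h2
    have h25 : 5 ^ 2 ≤ p ^ 2 := Nat.pow_le_pow_left h5 2
    omega
  · have hcop : Nat.Coprime (p ^ 12) (b ^ 10) :=
      Nat.Coprime.pow _ _ ((Nat.coprime_primes hpp hb).mpr hpb)
    have h432 : p ^ 12 ∣ 432 := hcop.dvd_of_dvd_mul_right hdvd'
    have hle : p ^ 12 ≤ 432 := Nat.le_of_dvd (by norm_num) h432
    have h2 : 2 ^ 12 ≤ p ^ 12 := Nat.pow_le_pow_left hpp.two_le 12
    norm_num at h2
    omega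

/-- Conductor bounds for `cm b`: `b² ∣ N ∣ 432 b²` (`f_b = 2`, `f₂ ≤ 4`, `f₃ ≤ 3`). -/
theorem cm_conductor_bounds {b : ℕ} (hb : b.Prime) (h5 : 5 ≤ b) :
    b ^ 2 ∣ ((cm b).baseChange ℚ).conductorNorm ℤ ∧ ((cm b).baseChange ℚ).conductorNorm ℤ ∣ 432 * b ^ 2 := by
  haveI : NeZero b := ⟨hb.ne_zero⟩
  have hmin := cm_isMinimalAt hb h5
  have hgen : ∀ p : Nat.Primes,
      Rat.HeightOneSpectrum.natGenerator ((Rat.HeightOneSpectrum.primesEquiv (R := ℤ)).symm p) = p :=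
    Literature.NumberTheory.EllipticCurves.Rat.natGenerator_primesEquiv_symm
  -- `f_b ≥ 2`
  have hfb : 2 ≤ ((cm b).baseChange ℚ).conductorExponent
      ((Rat.HeightOneSpectrum.primesEquiv (R := ℤ)).symm ⟨b, hb⟩) := by
    apply two_le_conductorExponent_of_dvd_Δ_of_dvd_c₄ (hmin _)
    · rw [hgen ⟨b, hb⟩, cm_Δ]; exact Dvd.intro (-432 * (b : ℤ) ^ 9) (by push_cast; ring)
    · rw [hgen ⟨b, hb⟩, cm_c₄]; exact dvd_zero _
  constructor
  · apply (Nat.Prime.pow_dvd_iff_le_factorization hb (conductorNorm_pos_holds _).ne').mpr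
    rw [factorization_conductorNorm_primesEquiv_symm _ ⟨b, hb⟩]
    exact hfb
  · apply conductorNorm_dvd_of_forall_conductorExponent_le _ (by positivity)
    intro p
    set v := (Rat.HeightOneSpectrum.primesEquiv (R := ℤ)).symm p with hv
    have hp : (p : ℕ).Prime := p.2
    have h0 : (432 * b ^ 2) ≠ 0 := by positivity
    by_cases hpb : (p : ℕ) = b
    · -- `f_b ≤ 2 ≤ ord_b (432 b²)`
      have h5' : 5 ≤ Rat.HeightOneSpectrum.natGenerator v := by rw [hgen p, hpb]; exact h5
      have hle := (conductorExponent_le_two_of_five_le_natGenerator_holds ((cm b).baseChange ℚ) v) h5'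
      refine hle.trans ?_
      apply (Nat.Prime.pow_dvd_iff_le_factorization hp h0).mp
      rw [hpb]; exact Dvd.intro_left 432 rfl
    · by_cases hpΔ : ((Rat.HeightOneSpectrum.natGenerator v : ℕ) : ℤ) ∣ (cm b).Δ
      · -- then `p ∣ 432`, so `p = 2` or `p = 3`; use `f_p < k` from `p^k ∤ Δ`
        have e : -(-432 * (b : ℤ) ^ 10) = ((432 * b ^ 10 : ℕ) : ℤ) := by push_cast; ring
        rw [hgen p, cm_Δ] at hpΔ
        have hp432 : (p : ℕ) ∣ 432 := by
          have h1 : (p : ℕ) ∣ 432 * b ^ 10 := by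
            have : ((p : ℕ) : ℤ) ∣ ((432 * b ^ 10 : ℕ) : ℤ) := by
              rw [← dvd_neg, e] at hpΔ; exact hpΔ
            exact_mod_cast this
          rcases (Nat.Prime.dvd_mul hp).mp h1 with h | h
          · exact h
          · exact absurd ((Nat.prime_dvd_prime_iff_eq hp hb).mp (hp.dvd_of_dvd_pow h)) hpb
        have hp23 : (p : ℕ) = 2 ∨ (p : ℕ) = 3 := by
          have : (p : ℕ) ∣ 2 ^ 4 * 3 ^ 3 := by norm_num; exact hp432
          rcases (Nat.Prime.dvd_mul hp).mp this with h | h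
          · exact Or.inl ((Nat.prime_dvd_prime_iff_eq hp Nat.prime_two).mp (hp.dvd_of_dvd_pow h))
          · exact Or.inr ((Nat.prime_dvd_prime_iff_eq hp Nat.prime_three).mp (hp.dvd_of_dvd_pow h))
        have hbodd2 : ¬ (2 : ℕ) ∣ b := fun h => by
          have := (Nat.prime_dvd_prime_iff_eq Nat.prime_two hb).mp h; omega
        have hbodd3 : ¬ (3 : ℕ) ∣ b := fun h => by
          have := (Nat.prime_dvd_prime_iff_eq Nat.prime_three hb).mp h; omega
        rcases hp23 with h2 | h3
        · -- `2^5 ∤ 432 b^10`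
          have hlt : ((cm b).baseChange ℚ).conductorExponent v < 5 := by
            apply conductorExponent_lt_of_not_pow_dvd (hmin v)
            rw [hgen p, h2, cm_Δ]
            intro hd
            have hd' : 2 ^ 5 ∣ 432 * b ^ 10 := by
              rw [← dvd_neg, e] at hd
              exact_mod_cast hd
            have hcop : Nat.Coprime (2 ^ 5) (b ^ 10) :=
              Nat.Coprime.pow _ _ ((Nat.Prime.coprime_iff_not_dvd Nat.prime_two).mpr hbodd2)
            have := hcop.dvd_of_dvd_mul_right hd'
            norm_num at this
          have : 4 ≤ (432 * b ^ 2).factorization (p : ℕ) := by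
            apply (Nat.Prime.pow_dvd_iff_le_factorization hp h0).mp
            rw [h2]; exact Dvd.intro (27 * b ^ 2) (by ring)
          omega
        · -- `3^4 ∤ 432 b^10`
          have hlt : ((cm b).baseChange ℚ).conductorExponent v < 4 := by
            apply conductorExponent_lt_of_not_pow_dvd (hmin v)
            rw [hgen p, h3, cm_Δ]
            intro hd
            have hd' : 3 ^ 4 ∣ 432 * b ^ 10 := by
              rw [← dvd_neg, e] at hd
              exact_mod_cast hd
            have hcop : Nat.Coprime (3 ^ 4) (b ^ 10) :=
              Nat.Coprime.pow _ _ ((Nat.Prime.coprime_iff_not_dvd Nat.prime_three).mpr hbodd3)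
            have := hcop.dvd_of_dvd_mul_right hd'
            norm_num at this
          have : 3 ≤ (432 * b ^ 2).factorization (p : ℕ) := by
            apply (Nat.Prime.pow_dvd_iff_le_factorization hp h0).mp
            rw [h3]; exact Dvd.intro (16 * b ^ 2) (by ring)
          omega
      · rw [conductorExponent_eq_zero_of_not_dvd_Δ (hmin v) hpΔ]
        exact Nat.zero_le _

/-- The crux window with the clause `c₄ ≠ 0` removed. -/
def windowNoC4 (κ σ X : ℝ) : Set (WeierstrassCurve ℤ) :=
  {W₀ : WeierstrassCurve ℤ | (W₀.baseChange ℚ).IsElliptic ∧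
    (∀ v : HeightOneSpectrum ℤ, (W₀.baseChange ℚ).IsMinimalAt v) ∧
    (W₀.a₁ = 0 ∨ W₀.a₁ = 1) ∧ (W₀.a₃ = 0 ∨ W₀.a₃ = 1) ∧ (W₀.a₂ = -1 ∨ W₀.a₂ = 0 ∨ W₀.a₂ = 1) ∧
    W₀.c₆ ≠ 0 ∧
    (((W₀.baseChange ℚ).conductorNorm ℤ : ℕ) : ℝ) ≤ X ∧
    (((W₀.baseChange ℚ).conductorNorm ℤ : ℕ) : ℝ) ^ κ ≤ ((max |W₀.Δ| (|W₀.c₄| ^ 3) : ℤ) : ℝ) ∧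
    ((max |W₀.Δ| (|W₀.c₄| ^ 3) : ℤ) : ℝ) ≤ (((W₀.baseChange ℚ).conductorNorm ℤ : ℕ) : ℝ) ^ σ}

def SharpModerateLawWithoutC4 : Prop :=
  ∀ κ σ ε : ℝ, 3 < κ → κ < 6 → 6 < σ → 0 < ε → ∃ C : ℝ, ∀ X : ℝ, 1 ≤ X →
    (Set.ncard (windowNoC4 κ σ X) : ℝ) ≤ C * X ^ (1 - κ / 6 + ε)

theorem windowNoC4_finite (κ σ X : ℝ) : (windowNoC4 κ σ X).Finite := by
  refine (reducedCap_finite (⌈max (1 : ℝ) (X ^ σ)⌉₊ : ℕ)).subset ?_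
  intro W hW
  obtain ⟨hE, -, h₁, h₃, h₂, -, hNX, -, hM⟩ := hW
  refine ⟨h₁, h₃, h₂, ?_⟩
  haveI := hE
  have hN1 : (1 : ℝ) ≤ (((W.baseChange ℚ).conductorNorm ℤ : ℕ) : ℝ) := by
    exact_mod_cast conductorNorm_pos_holds (W.baseChange ℚ)
  have hM' : ((max |W.Δ| (|W.c₄| ^ 3) : ℤ) : ℝ) ≤ max 1 (X ^ σ) := by
    refine hM.trans ?_
    rcases le_or_gt 0 σ with hσ | hσ
    · exact le_max_of_le_right (Real.rpow_le_rpow (by linarith) hNX hσ)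
    · exact le_max_of_le_left (Real.rpow_le_one_of_one_le_of_nonpos hN1 hσ.le)
  have : ((max |W.Δ| (|W.c₄| ^ 3) : ℤ) : ℝ) ≤ ((⌈max (1 : ℝ) (X ^ σ)⌉₊ : ℕ) : ℝ) :=
    hM'.trans (Nat.le_ceil _)
  exact_mod_cast this

/-- Membership: prime `b ≥ 8979`, `432 b² ≤ X` ⟹ `cm b ∈ windowNoC4 4 7 X`. -/
theorem cm_mem_windowNoC4 {b : ℕ} (hb : b.Prime) (h8979 : 8979 ≤ b) {X : ℝ} (hX : 432 * (b : ℝ) ^ 2 ≤ X) :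
    cm b ∈ windowNoC4 4 7 X := by
  haveI : NeZero b := ⟨hb.ne_zero⟩
  obtain ⟨hlo, hhi⟩ := cm_conductor_bounds hb (by omega)
  set N := ((cm b).baseChange ℚ).conductorNorm ℤ with hN
  have hNpos : 0 < N := conductorNorm_pos_holds _
  have hloN : b ^ 2 ≤ N := Nat.le_of_dvd hNpos hlo
  have hhiN : N ≤ 432 * b ^ 2 := Nat.le_of_dvd (by positivity) hhi
  have hloR : (b : ℝ) ^ 2 ≤ (N : ℝ) := by exact_mod_cast hloN
  have hhiR : (N : ℝ) ≤ 432 * (b : ℝ) ^ 2 := by exact_mod_cast hhiN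
  have hb0 : (0 : ℝ) < b := by exact_mod_cast hb.pos
  have hbR : (8979 : ℝ) ≤ b := by exact_mod_cast h8979
  refine ⟨inferInstance, cm_isMinimalAt hb (by omega), Or.inl rfl, Or.inl rfl, Or.inr (Or.inl rfl),
    ?_, hhiR.trans hX, ?_, ?_⟩
  · rw [cm_c₆]; exact mul_ne_zero (by norm_num) (pow_ne_zero _ (by exact_mod_cast hb.ne_zero))
  · -- `N⁴ ≤ (432 b²)⁴ ≤ 432 b¹⁰` since `432³ ≤ b²`
    rw [cm_maxInv, show (4 : ℝ) = ((4 : ℕ) : ℝ) by norm_num, Real.rpow_natCast]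
    push_cast
    calc (N : ℝ) ^ 4 ≤ (432 * (b : ℝ) ^ 2) ^ 4 := pow_le_pow_left₀ (by positivity) hhiR 4
      _ = 432 * (432 ^ 3 * ((b : ℝ) ^ 2) ^ 3 * (b : ℝ) ^ 2) := by ring
      _ ≤ 432 * ((b : ℝ) ^ 2 * ((b : ℝ) ^ 2) ^ 3 * (b : ℝ) ^ 2) := by
          apply mul_le_mul_of_nonneg_left _ (by norm_num)
          apply mul_le_mul_of_nonneg_right _ (by positivity)
          apply mul_le_mul_of_nonneg_right _ (by positivity)
          calc (432 : ℝ) ^ 3 ≤ 8979 ^ 2 := by norm_num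
            _ ≤ (b : ℝ) ^ 2 := pow_le_pow_left₀ (by norm_num) hbR 2
      _ = 432 * (b : ℝ) ^ 10 := by ring
  · -- `432 b¹⁰ ≤ (b²)⁷ ≤ N⁷`
    rw [cm_maxInv, show (7 : ℝ) = ((7 : ℕ) : ℝ) by norm_num, Real.rpow_natCast]
    push_cast
    calc (432 : ℝ) * (b : ℝ) ^ 10 ≤ (b : ℝ) ^ 4 * (b : ℝ) ^ 10 := by
          apply mul_le_mul_of_nonneg_right _ (by positivity)
          calc (432 : ℝ) ≤ 8979 ^ 4 := by norm_num
            _ ≤ (b : ℝ) ^ 4 := pow_le_pow_left₀ (by norm_num) hbR 4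
      _ = ((b : ℝ) ^ 2) ^ 7 := by ring
      _ ≤ (N : ℝ) ^ 7 := pow_le_pow_left₀ (by positivity) hloR 7

theorem cm_injective : Function.Injective cm := by
  intro b b' h
  have h6 : (cm b).a₆ = (cm b').a₆ := by rw [h]
  simp only [cm] at h6
  have h6' : b ^ 5 = b' ^ 5 := by exact_mod_cast h6
  exact Nat.pow_left_injective (by norm_num) h6'

theorem card_primesIoc_le_ncard_noC4 (T : ℕ) :
    ((primesIoc 8978 T).card : ℝ) ≤ (Set.ncard (windowNoC4 4 7 (432 * (T : ℝ) ^ 2)) : ℝ) := by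
  classical
  set S := primesIoc 8978 T with hS
  have hmem : ∀ b ∈ S, b.Prime ∧ 8979 ≤ b ∧ b ≤ T := by
    intro b hb
    rw [hS, primesIoc, Finset.mem_filter, Finset.mem_Ioc] at hb
    exact ⟨hb.2, by omega, hb.1.2⟩
  clear_value S
  have hsub : (↑(S.image cm) : Set (WeierstrassCurve ℤ)) ⊆ windowNoC4 4 7 (432 * (T : ℝ) ^ 2) := by
    intro W hW
    rw [Finset.coe_image] at hW
    obtain ⟨b, hb, rfl⟩ := hW
    obtain ⟨hp, h1, hbT⟩ := hmem b hb
    refine cm_mem_windowNoC4 hp h1 ?_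
    have : (b : ℝ) ≤ T := by exact_mod_cast hbT
    have : (b : ℝ) ^ 2 ≤ (T : ℝ) ^ 2 := pow_le_pow_left₀ (by positivity) this 2
    linarith
  have h1 : S.card = (S.image cm).card := (Finset.card_image_of_injective _ cm_injective).symm
  have h2 : (S.image cm).card = Set.ncard (↑(S.image cm) : Set (WeierstrassCurve ℤ)) :=
    (Set.ncard_coe_finset _).symm
  have h3 := Set.ncard_le_ncard hsub (windowNoC4_finite _ _ _)
  have h4 : S.card ≤ Set.ncard (windowNoC4 4 7 (432 * (T : ℝ) ^ 2)) := by
    rw [h1, h2]; exact h3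
  exact_mod_cast h4

/-- **`c₄ ≠ 0` is load-bearing**: `¬ SharpModerateLawWithoutC4` (`κ = 4`, `σ = 7`, `ε = 1/12`,
`X = 432 m²⁴`, primes `b ∈ (8978, m¹²]`). -/
theorem not_sharpModerateLawWithoutC4 : ¬ SharpModerateLawWithoutC4 := by
  intro h
  obtain ⟨C, hC⟩ := h 4 7 (1 / 12) (by norm_num) (by norm_num) (by norm_num) (by norm_num)
  obtain ⟨T₁, hT₁⟩ := primesIoc_card_mul_log_ge 8978
  set m : ℕ := T₁ + 20736 * ⌈C⌉₊ + 2 with hm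
  have hm2 : (2 : ℝ) ≤ m := by
    have : 2 ≤ m := by omega
    exact_mod_cast this
  have hm0 : (0 : ℝ) < m := by linarith
  have hmC : 20736 * C < m := by
    have h1 : C ≤ ⌈C⌉₊ := Nat.le_ceil C
    have h2 : ((T₁ + 20736 * ⌈C⌉₊ + 2 : ℕ) : ℝ) = m := by rw [hm]
    push_cast at h2
    have : (0 : ℝ) ≤ T₁ := by positivity
    linarith
  have hT₁m : T₁ ≤ m ^ 12 := by
    calc T₁ ≤ m := by omega
      _ = m ^ 1 := (pow_one m).symm
      _ ≤ m ^ 12 := Nat.pow_le_pow_right (by omega) (by norm_num)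
  clear_value m
  have hsup := hT₁ (m ^ 12) hT₁m
  push_cast at hsup
  rw [Real.log_pow] at hsup
  have hlogm : Real.log m ≤ m := by
    have := Real.log_le_sub_one_of_pos hm0; linarith
  have hX1 : (1 : ℝ) ≤ 432 * ((m : ℝ) ^ 12) ^ 2 := by
    have : (1 : ℝ) ≤ ((m : ℝ) ^ 12) ^ 2 := one_le_pow₀ (one_le_pow₀ (by linarith))
    linarith
  have hlaw := hC (432 * ((m : ℝ) ^ 12) ^ 2) hX1
  have hcount := card_primesIoc_le_ncard_noC4 (m ^ 12)
  push_cast at hcount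
  set P : ℝ := ((primesIoc 8978 (m ^ 12)).card : ℝ) with hP
  have hcard0 : (0 : ℝ) ≤ P := by rw [hP]; exact Nat.cast_nonneg _
  clear_value P
  have hexp : (432 * ((m : ℝ) ^ 12) ^ 2) ^ (1 - 4 / 6 + 1 / 12 : ℝ) ≤ 432 * (m : ℝ) ^ 10 := by
    rw [show (1 - 4 / 6 + 1 / 12 : ℝ) = 5 / 12 by norm_num,
      Real.mul_rpow (by norm_num) (by positivity)]
    have e1 : (((m : ℝ) ^ 12) ^ 2) ^ (5 / 12 : ℝ) = (m : ℝ) ^ 10 := by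
      rw [← pow_mul, ← Real.rpow_natCast (m : ℝ) (12 * 2), ← Real.rpow_mul hm0.le]
      rw [show ((12 * 2 : ℕ) : ℝ) * (5 / 12) = ((10 : ℕ) : ℝ) by norm_num, Real.rpow_natCast]
    have e2 : (432 : ℝ) ^ (5 / 12 : ℝ) ≤ 432 := by
      calc (432 : ℝ) ^ (5 / 12 : ℝ) ≤ (432 : ℝ) ^ (1 : ℝ) :=
            Real.rpow_le_rpow_of_exponent_le (by norm_num) (by norm_num)
        _ = 432 := Real.rpow_one _
    rw [e1]
    exact mul_le_mul_of_nonneg_right e2 (by positivity)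
  have hA : (m : ℝ) ^ 12 / 4 ≤ 12 * m * P := by
    calc (m : ℝ) ^ 12 / 4 ≤ P * (12 * Real.log m) := hsup
      _ ≤ P * (12 * m) := by
          apply mul_le_mul_of_nonneg_left _ hcard0; linarith
      _ = 12 * m * P := by ring
  rcases lt_or_ge C 0 with hC0 | hC0
  · have : C * (432 * ((m : ℝ) ^ 12) ^ 2) ^ (1 - 4 / 6 + 1 / 12 : ℝ) < 0 :=
      mul_neg_of_neg_of_pos hC0 (Real.rpow_pos_of_pos (by positivity) _)
    linarith
  have hB : P ≤ C * (432 * (m : ℝ) ^ 10) :=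
    (hcount.trans hlaw).trans (mul_le_mul_of_nonneg_left hexp hC0)
  have h12m : (0 : ℝ) ≤ 12 * m := by linarith
  have hD : (m : ℝ) ^ 12 / 4 ≤ 5184 * C * (m : ℝ) ^ 11 := by
    calc (m : ℝ) ^ 12 / 4 ≤ 12 * m * P := hA
      _ ≤ 12 * m * (C * (432 * (m : ℝ) ^ 10)) := mul_le_mul_of_nonneg_left hB h12m
      _ = 5184 * C * (m : ℝ) ^ 11 := by ring
  have hm11 : (0 : ℝ) < (m : ℝ) ^ 11 := by positivity
  have hE : (m : ℝ) ≤ 20736 * C := by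
    have : (m : ℝ) ^ 12 / 4 = ((m : ℝ) / 4) * (m : ℝ) ^ 11 := by ring
    rw [this] at hD
    have := le_of_mul_le_mul_right (by linarith : (m : ℝ) / 4 * (m : ℝ) ^ 11 ≤ 5184 * C * (m : ℝ) ^ 11) hm11
    linarith
  linarith

/-! ## 6. `c₆ ≠ 0` is load-bearing (re-certified): quartic twists of `j = 1728`

`qt b : y² = x³ + b³ x` (`b ≥ 5` prime): reduced, minimal (`Δ = −64 b⁹`), `c₄ = −48 b³ ≠ 0`, `c₆ = 0`,
`f_b = 2` so `b² ∣ N ∣ 64 b²`, `M⁺ = 110592 b⁹`, ratio `→ 9/2`. At `κ = 4`, `σ = 7`, `ε = 1/12` the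
`≍ X^{1/2}/log X` members (`64 b² ≤ X`, `b ≥ 157`) beat `C X^{5/12}`. -/

/-- `qt b : y² = x³ + b³ x` (`j = 1728`). -/
def qt (b : ℕ) : WeierstrassCurve ℤ := ⟨0, 0, 0, (b : ℤ) ^ 3, 0⟩

theorem qt_c₄ (b : ℕ) : (qt b).c₄ = -48 * (b : ℤ) ^ 3 := by
  simp only [qt, WeierstrassCurve.c₄, WeierstrassCurve.b₂, WeierstrassCurve.b₄]; ring

theorem qt_c₆ (b : ℕ) : (qt b).c₆ = 0 := by
  simp [qt, WeierstrassCurve.c₆, WeierstrassCurve.b₂, WeierstrassCurve.b₄, WeierstrassCurve.b₆]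

theorem qt_Δ (b : ℕ) : (qt b).Δ = -64 * (b : ℤ) ^ 9 := by
  simp only [qt, WeierstrassCurve.Δ, WeierstrassCurve.b₂, WeierstrassCurve.b₄, WeierstrassCurve.b₆,
    WeierstrassCurve.b₈]
  ring

theorem qt_maxInv (b : ℕ) : max |(qt b).Δ| (|(qt b).c₄| ^ 3) = 110592 * (b : ℤ) ^ 9 := by
  rw [qt_Δ, qt_c₄, abs_mul, abs_mul, abs_of_nonpos (by norm_num : (-64 : ℤ) ≤ 0),
    abs_of_nonpos (by norm_num : (-48 : ℤ) ≤ 0), abs_pow, abs_pow, Nat.abs_cast]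
  rw [max_eq_right]
  · ring
  · have : (0 : ℤ) ≤ (b : ℤ) ^ 9 := by positivity
    nlinarith

instance qt_isElliptic (b : ℕ) [NeZero b] : ((qt b).baseChange ℚ).IsElliptic := by
  refine ⟨?_⟩
  rw [baseChange_int_Δ, qt_Δ, isUnit_iff_ne_zero]
  have : (b : ℚ) ≠ 0 := by exact_mod_cast NeZero.ne b
  push_cast
  exact mul_ne_zero (by norm_num) (pow_ne_zero _ this)

theorem qt_isMinimalAt {b : ℕ} (hb : b.Prime) (h5 : 5 ≤ b) (v : HeightOneSpectrum ℤ) :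
    ((qt b).baseChange ℚ).IsMinimalAt v := by
  apply isMinimalAt_baseChange_int_of_not_pow_dvd_Δ
  rw [qt_Δ]
  set p := Rat.HeightOneSpectrum.natGenerator v with hp
  have hpp : p.Prime := Rat.HeightOneSpectrum.prime_natGenerator v
  intro hdvd
  have e : -(-64 * (b : ℤ) ^ 9) = ((64 * b ^ 9 : ℕ) : ℤ) := by push_cast; ring
  have hdvd' : p ^ 12 ∣ 64 * b ^ 9 := by
    have : ((p : ℤ) ^ 12) ∣ ((64 * b ^ 9 : ℕ) : ℤ) := by rw [← dvd_neg, e] at hdvd; exact hdvd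
    exact_mod_cast this
  by_cases hpb : p = b
  · subst hpb
    have h3 : p ^ 3 ∣ 64 := by
      have : p ^ 12 = p ^ 9 * p ^ 3 := by ring
      rw [this, mul_comm 64] at hdvd'
      exact (Nat.mul_dvd_mul_iff_left (pow_pos hpp.pos 9)).mp hdvd'
    have : p ^ 3 ≤ 64 := Nat.le_of_dvd (by norm_num) h3
    have h125 : 5 ^ 3 ≤ p ^ 3 := Nat.pow_le_pow_left h5 3
    omega
  · have hcop : Nat.Coprime (p ^ 12) (b ^ 9) :=
      Nat.Coprime.pow _ _ ((Nat.coprime_primes hpp hb).mpr hpb)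
    have h64 : p ^ 12 ∣ 64 := hcop.dvd_of_dvd_mul_right hdvd'
    have hle : p ^ 12 ≤ 64 := Nat.le_of_dvd (by norm_num) h64
    have h2 : 2 ^ 12 ≤ p ^ 12 := Nat.pow_le_pow_left hpp.two_le 12
    norm_num at h2
    omega

/-- Conductor bounds for `qt b`: `b² ∣ N ∣ 64 b²` (`f_b = 2`, `f₂ ≤ 6`). -/
theorem qt_conductor_bounds {b : ℕ} (hb : b.Prime) (h5 : 5 ≤ b) :
    b ^ 2 ∣ ((qt b).baseChange ℚ).conductorNorm ℤ ∧ ((qt b).baseChange ℚ).conductorNorm ℤ ∣ 64 * b ^ 2 := by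
  haveI : NeZero b := ⟨hb.ne_zero⟩
  have hmin := qt_isMinimalAt hb h5
  have hgen : ∀ p : Nat.Primes,
      Rat.HeightOneSpectrum.natGenerator ((Rat.HeightOneSpectrum.primesEquiv (R := ℤ)).symm p) = p :=
    Literature.NumberTheory.EllipticCurves.Rat.natGenerator_primesEquiv_symm
  have hfb : 2 ≤ ((qt b).baseChange ℚ).conductorExponent
      ((Rat.HeightOneSpectrum.primesEquiv (R := ℤ)).symm ⟨b, hb⟩) := by
    apply two_le_conductorExponent_of_dvd_Δ_of_dvd_c₄ (hmin _)
    · rw [hgen ⟨b, hb⟩, qt_Δ]; exact Dvd.intro (-64 * (b : ℤ) ^ 8) (by push_cast; ring)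
    · rw [hgen ⟨b, hb⟩, qt_c₄]; exact Dvd.intro (-48 * (b : ℤ) ^ 2) (by push_cast; ring)
  constructor
  · apply (Nat.Prime.pow_dvd_iff_le_factorization hb (conductorNorm_pos_holds _).ne').mpr
    rw [factorization_conductorNorm_primesEquiv_symm _ ⟨b, hb⟩]
    exact hfb
  · apply conductorNorm_dvd_of_forall_conductorExponent_le _ (by positivity)
    intro p
    set v := (Rat.HeightOneSpectrum.primesEquiv (R := ℤ)).symm p with hv
    have hp : (p : ℕ).Prime := p.2
    have h0 : (64 * b ^ 2) ≠ 0 := by positivity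
    by_cases hpb : (p : ℕ) = b
    · have h5' : 5 ≤ Rat.HeightOneSpectrum.natGenerator v := by rw [hgen p, hpb]; exact h5
      have hle := (conductorExponent_le_two_of_five_le_natGenerator_holds ((qt b).baseChange ℚ) v) h5'
      refine hle.trans ?_
      apply (Nat.Prime.pow_dvd_iff_le_factorization hp h0).mp
      rw [hpb]; exact Dvd.intro_left 64 rfl
    · by_cases hpΔ : ((Rat.HeightOneSpectrum.natGenerator v : ℕ) : ℤ) ∣ (qt b).Δ
      · have e : -(-64 * (b : ℤ) ^ 9) = ((64 * b ^ 9 : ℕ) : ℤ) := by push_cast; ring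
        rw [hgen p, qt_Δ] at hpΔ
        have hp64 : (p : ℕ) ∣ 64 := by
          have h1 : (p : ℕ) ∣ 64 * b ^ 9 := by
            have : ((p : ℕ) : ℤ) ∣ ((64 * b ^ 9 : ℕ) : ℤ) := by
              rw [← dvd_neg, e] at hpΔ; exact hpΔ
            exact_mod_cast this
          rcases (Nat.Prime.dvd_mul hp).mp h1 with h | h
          · exact h
          · exact absurd ((Nat.prime_dvd_prime_iff_eq hp hb).mp (hp.dvd_of_dvd_pow h)) hpb
        have hp2 : (p : ℕ) = 2 := by
          have : (p : ℕ) ∣ 2 ^ 6 := by norm_num; exact hp64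
          exact (Nat.prime_dvd_prime_iff_eq hp Nat.prime_two).mp (hp.dvd_of_dvd_pow this)
        have hbodd2 : ¬ (2 : ℕ) ∣ b := fun h => by
          have := (Nat.prime_dvd_prime_iff_eq Nat.prime_two hb).mp h; omega
        -- `2^7 ∤ 64 b^9`
        have hlt : ((qt b).baseChange ℚ).conductorExponent v < 7 := by
          apply conductorExponent_lt_of_not_pow_dvd (hmin v)
          rw [hgen p, hp2, qt_Δ]
          intro hd
          have hd' : 2 ^ 7 ∣ 64 * b ^ 9 := by
            rw [← dvd_neg, e] at hd
            exact_mod_cast hd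
          have hcop : Nat.Coprime (2 ^ 7) (b ^ 9) :=
            Nat.Coprime.pow _ _ ((Nat.Prime.coprime_iff_not_dvd Nat.prime_two).mpr hbodd2)
          have := hcop.dvd_of_dvd_mul_right hd'
          norm_num at this
        have : 6 ≤ (64 * b ^ 2).factorization (p : ℕ) := by
          apply (Nat.Prime.pow_dvd_iff_le_factorization hp h0).mp
          rw [hp2]; exact Dvd.intro (b ^ 2) (by ring)
        omega
      · rw [conductorExponent_eq_zero_of_not_dvd_Δ (hmin v) hpΔ]
        exact Nat.zero_le _

/-- The crux window with the clause `c₆ ≠ 0` removed. -/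
def windowNoC6 (κ σ X : ℝ) : Set (WeierstrassCurve ℤ) :=
  {W₀ : WeierstrassCurve ℤ | (W₀.baseChange ℚ).IsElliptic ∧
    (∀ v : HeightOneSpectrum ℤ, (W₀.baseChange ℚ).IsMinimalAt v) ∧
    (W₀.a₁ = 0 ∨ W₀.a₁ = 1) ∧ (W₀.a₃ = 0 ∨ W₀.a₃ = 1) ∧ (W₀.a₂ = -1 ∨ W₀.a₂ = 0 ∨ W₀.a₂ = 1) ∧
    W₀.c₄ ≠ 0 ∧
    (((W₀.baseChange ℚ).conductorNorm ℤ : ℕ) : ℝ) ≤ X ∧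
    (((W₀.baseChange ℚ).conductorNorm ℤ : ℕ) : ℝ) ^ κ ≤ ((max |W₀.Δ| (|W₀.c₄| ^ 3) : ℤ) : ℝ) ∧
    ((max |W₀.Δ| (|W₀.c₄| ^ 3) : ℤ) : ℝ) ≤ (((W₀.baseChange ℚ).conductorNorm ℤ : ℕ) : ℝ) ^ σ}

def SharpModerateLawWithoutC6 : Prop :=
  ∀ κ σ ε : ℝ, 3 < κ → κ < 6 → 6 < σ → 0 < ε → ∃ C : ℝ, ∀ X : ℝ, 1 ≤ X →
    (Set.ncard (windowNoC6 κ σ X) : ℝ) ≤ C * X ^ (1 - κ / 6 + ε)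

theorem windowNoC6_finite (κ σ X : ℝ) : (windowNoC6 κ σ X).Finite := by
  refine (reducedCap_finite (⌈max (1 : ℝ) (X ^ σ)⌉₊ : ℕ)).subset ?_
  intro W hW
  obtain ⟨hE, -, h₁, h₃, h₂, -, hNX, -, hM⟩ := hW
  refine ⟨h₁, h₃, h₂, ?_⟩
  haveI := hE
  have hN1 : (1 : ℝ) ≤ (((W.baseChange ℚ).conductorNorm ℤ : ℕ) : ℝ) := by
    exact_mod_cast conductorNorm_pos_holds (W.baseChange ℚ)
  have hM' : ((max |W.Δ| (|W.c₄| ^ 3) : ℤ) : ℝ) ≤ max 1 (X ^ σ) := by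
    refine hM.trans ?_
    rcases le_or_gt 0 σ with hσ | hσ
    · exact le_max_of_le_right (Real.rpow_le_rpow (by linarith) hNX hσ)
    · exact le_max_of_le_left (Real.rpow_le_one_of_one_le_of_nonpos hN1 hσ.le)
  have : ((max |W.Δ| (|W.c₄| ^ 3) : ℤ) : ℝ) ≤ ((⌈max (1 : ℝ) (X ^ σ)⌉₊ : ℕ) : ℝ) :=
    hM'.trans (Nat.le_ceil _)
  exact_mod_cast this

/-- Membership: prime `b ≥ 157`, `64 b² ≤ X` ⟹ `qt b ∈ windowNoC6 4 7 X`. -/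
theorem qt_mem_windowNoC6 {b : ℕ} (hb : b.Prime) (h157 : 157 ≤ b) {X : ℝ} (hX : 64 * (b : ℝ) ^ 2 ≤ X) :
    qt b ∈ windowNoC6 4 7 X := by
  haveI : NeZero b := ⟨hb.ne_zero⟩
  obtain ⟨hlo, hhi⟩ := qt_conductor_bounds hb (by omega)
  set N := ((qt b).baseChange ℚ).conductorNorm ℤ with hN
  have hNpos : 0 < N := conductorNorm_pos_holds _
  have hloN : b ^ 2 ≤ N := Nat.le_of_dvd hNpos hlo
  have hhiN : N ≤ 64 * b ^ 2 := Nat.le_of_dvd (by positivity) hhi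
  have hloR : (b : ℝ) ^ 2 ≤ (N : ℝ) := by exact_mod_cast hloN
  have hhiR : (N : ℝ) ≤ 64 * (b : ℝ) ^ 2 := by exact_mod_cast hhiN
  have hb0 : (0 : ℝ) < b := by exact_mod_cast hb.pos
  have hbR : (157 : ℝ) ≤ b := by exact_mod_cast h157
  refine ⟨inferInstance, qt_isMinimalAt hb (by omega), Or.inl rfl, Or.inl rfl, Or.inr (Or.inl rfl),
    ?_, hhiR.trans hX, ?_, ?_⟩
  · rw [qt_c₄]; exact mul_ne_zero (by norm_num) (pow_ne_zero _ (by exact_mod_cast hb.ne_zero))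
  · -- `N⁴ ≤ (64 b²)⁴ = 2²⁴ b⁸ ≤ 110592 b⁹` since `2²⁴ ≤ 110592 · 157`
    rw [qt_maxInv, show (4 : ℝ) = ((4 : ℕ) : ℝ) by norm_num, Real.rpow_natCast]
    push_cast
    calc (N : ℝ) ^ 4 ≤ (64 * (b : ℝ) ^ 2) ^ 4 := pow_le_pow_left₀ (by positivity) hhiR 4
      _ = 64 ^ 4 * (b : ℝ) ^ 8 := by ring
      _ ≤ 110592 * 157 * (b : ℝ) ^ 8 := mul_le_mul_of_nonneg_right (by norm_num) (by positivity)
      _ ≤ 110592 * (b : ℝ) * (b : ℝ) ^ 8 := by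
          apply mul_le_mul_of_nonneg_right _ (by positivity)
          exact mul_le_mul_of_nonneg_left hbR (by norm_num)
      _ = 110592 * (b : ℝ) ^ 9 := by ring
  · -- `110592 b⁹ ≤ b⁵ b⁹ = (b²)⁷ ≤ N⁷`
    rw [qt_maxInv, show (7 : ℝ) = ((7 : ℕ) : ℝ) by norm_num, Real.rpow_natCast]
    push_cast
    calc (110592 : ℝ) * (b : ℝ) ^ 9 ≤ (b : ℝ) ^ 5 * (b : ℝ) ^ 9 := by
          apply mul_le_mul_of_nonneg_right _ (by positivity)
          calc (110592 : ℝ) ≤ 157 ^ 5 := by norm_num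
            _ ≤ (b : ℝ) ^ 5 := pow_le_pow_left₀ (by norm_num) hbR 5
      _ = ((b : ℝ) ^ 2) ^ 7 := by ring
      _ ≤ (N : ℝ) ^ 7 := pow_le_pow_left₀ (by positivity) hloR 7

theorem qt_injective : Function.Injective qt := by
  intro b b' h
  have h4 : (qt b).a₄ = (qt b').a₄ := by rw [h]
  simp only [qt] at h4
  have h4' : b ^ 3 = b' ^ 3 := by exact_mod_cast h4
  exact Nat.pow_left_injective (by norm_num) h4'

theorem card_primesIoc_le_ncard_noC6 (T : ℕ) :
    ((primesIoc 156 T).card : ℝ) ≤ (Set.ncard (windowNoC6 4 7 (64 * (T : ℝ) ^ 2)) : ℝ) := by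
  classical
  set S := primesIoc 156 T with hS
  have hmem : ∀ b ∈ S, b.Prime ∧ 157 ≤ b ∧ b ≤ T := by
    intro b hb
    rw [hS, primesIoc, Finset.mem_filter, Finset.mem_Ioc] at hb
    exact ⟨hb.2, by omega, hb.1.2⟩
  clear_value S
  have hsub : (↑(S.image qt) : Set (WeierstrassCurve ℤ)) ⊆ windowNoC6 4 7 (64 * (T : ℝ) ^ 2) := by
    intro W hW
    rw [Finset.coe_image] at hW
    obtain ⟨b, hb, rfl⟩ := hW
    obtain ⟨hp, h1, hbT⟩ := hmem b hb
    refine qt_mem_windowNoC6 hp h1 ?_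
    have : (b : ℝ) ≤ T := by exact_mod_cast hbT
    have : (b : ℝ) ^ 2 ≤ (T : ℝ) ^ 2 := pow_le_pow_left₀ (by positivity) this 2
    linarith
  have h1 : S.card = (S.image qt).card := (Finset.card_image_of_injective _ qt_injective).symm
  have h2 : (S.image qt).card = Set.ncard (↑(S.image qt) : Set (WeierstrassCurve ℤ)) :=
    (Set.ncard_coe_finset _).symm
  have h3 := Set.ncard_le_ncard hsub (windowNoC6_finite _ _ _)
  have h4 : S.card ≤ Set.ncard (windowNoC6 4 7 (64 * (T : ℝ) ^ 2)) := by
    rw [h1, h2]; exact h3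
  exact_mod_cast h4

/-- **`c₆ ≠ 0` is load-bearing**: `¬ SharpModerateLawWithoutC6` (`κ = 4`, `σ = 7`, `ε = 1/12`,
`X = 64 m²⁴`, primes `b ∈ (156, m¹²]`). -/
theorem not_sharpModerateLawWithoutC6 : ¬ SharpModerateLawWithoutC6 := by
  intro h
  obtain ⟨C, hC⟩ := h 4 7 (1 / 12) (by norm_num) (by norm_num) (by norm_num) (by norm_num)
  obtain ⟨T₁, hT₁⟩ := primesIoc_card_mul_log_ge 156
  set m : ℕ := T₁ + 3072 * ⌈C⌉₊ + 2 with hm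
  have hm2 : (2 : ℝ) ≤ m := by
    have : 2 ≤ m := by omega
    exact_mod_cast this
  have hm0 : (0 : ℝ) < m := by linarith
  have hmC : 3072 * C < m := by
    have h1 : C ≤ ⌈C⌉₊ := Nat.le_ceil C
    have h2 : ((T₁ + 3072 * ⌈C⌉₊ + 2 : ℕ) : ℝ) = m := by rw [hm]
    push_cast at h2
    have : (0 : ℝ) ≤ T₁ := by positivity
    linarith
  have hT₁m : T₁ ≤ m ^ 12 := by
    calc T₁ ≤ m := by omega
      _ = m ^ 1 := (pow_one m).symm
      _ ≤ m ^ 12 := Nat.pow_le_pow_right (by omega) (by norm_num)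
  clear_value m
  have hsup := hT₁ (m ^ 12) hT₁m
  push_cast at hsup
  rw [Real.log_pow] at hsup
  have hlogm : Real.log m ≤ m := by
    have := Real.log_le_sub_one_of_pos hm0; linarith
  have hX1 : (1 : ℝ) ≤ 64 * ((m : ℝ) ^ 12) ^ 2 := by
    have : (1 : ℝ) ≤ ((m : ℝ) ^ 12) ^ 2 := one_le_pow₀ (one_le_pow₀ (by linarith))
    linarith
  have hlaw := hC (64 * ((m : ℝ) ^ 12) ^ 2) hX1
  have hcount := card_primesIoc_le_ncard_noC6 (m ^ 12)
  push_cast at hcount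
  set P : ℝ := ((primesIoc 156 (m ^ 12)).card : ℝ) with hP
  have hcard0 : (0 : ℝ) ≤ P := by rw [hP]; exact Nat.cast_nonneg _
  clear_value P
  have hexp : (64 * ((m : ℝ) ^ 12) ^ 2) ^ (1 - 4 / 6 + 1 / 12 : ℝ) ≤ 64 * (m : ℝ) ^ 10 := by
    rw [show (1 - 4 / 6 + 1 / 12 : ℝ) = 5 / 12 by norm_num,
      Real.mul_rpow (by norm_num) (by positivity)]
    have e1 : (((m : ℝ) ^ 12) ^ 2) ^ (5 / 12 : ℝ) = (m : ℝ) ^ 10 := by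
      rw [← pow_mul, ← Real.rpow_natCast (m : ℝ) (12 * 2), ← Real.rpow_mul hm0.le]
      rw [show ((12 * 2 : ℕ) : ℝ) * (5 / 12) = ((10 : ℕ) : ℝ) by norm_num, Real.rpow_natCast]
    have e2 : (64 : ℝ) ^ (5 / 12 : ℝ) ≤ 64 := by
      calc (64 : ℝ) ^ (5 / 12 : ℝ) ≤ (64 : ℝ) ^ (1 : ℝ) :=
            Real.rpow_le_rpow_of_exponent_le (by norm_num) (by norm_num)
        _ = 64 := Real.rpow_one _
    rw [e1]
    exact mul_le_mul_of_nonneg_right e2 (by positivity)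
  have hA : (m : ℝ) ^ 12 / 4 ≤ 12 * m * P := by
    calc (m : ℝ) ^ 12 / 4 ≤ P * (12 * Real.log m) := hsup
      _ ≤ P * (12 * m) := by
          apply mul_le_mul_of_nonneg_left _ hcard0; linarith
      _ = 12 * m * P := by ring
  rcases lt_or_ge C 0 with hC0 | hC0
  · have : C * (64 * ((m : ℝ) ^ 12) ^ 2) ^ (1 - 4 / 6 + 1 / 12 : ℝ) < 0 :=
      mul_neg_of_neg_of_pos hC0 (Real.rpow_pos_of_pos (by positivity) _)
    linarith
  have hB : P ≤ C * (64 * (m : ℝ) ^ 10) :=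
    (hcount.trans hlaw).trans (mul_le_mul_of_nonneg_left hexp hC0)
  have h12m : (0 : ℝ) ≤ 12 * m := by linarith
  have hD : (m : ℝ) ^ 12 / 4 ≤ 768 * C * (m : ℝ) ^ 11 := by
    calc (m : ℝ) ^ 12 / 4 ≤ 12 * m * P := hA
      _ ≤ 12 * m * (C * (64 * (m : ℝ) ^ 10)) := mul_le_mul_of_nonneg_left hB h12m
      _ = 768 * C * (m : ℝ) ^ 11 := by ring
  have hm11 : (0 : ℝ) < (m : ℝ) ^ 11 := by positivity
  have hE : (m : ℝ) ≤ 3072 * C := by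
    have : (m : ℝ) ^ 12 / 4 = ((m : ℝ) / 4) * (m : ℝ) ^ 11 := by ring
    rw [this] at hD
    have := le_of_mul_le_mul_right (by linarith : (m : ℝ) / 4 * (m : ℝ) ^ 11 ≤ 768 * C * (m : ℝ) ^ 11) hm11
    linarith
  linarith

/-! ## 7. Minimality is load-bearing (re-certified): non-minimal scalings of one twist

Dropping "minimal at every `v`" admits, for each curve, all its integral rescalings
`sc b k : y² = x³ − b²k⁴ x + b³k⁶` (`k ≥ 1`), ℚ-isomorphic to `tw b` (so the SAME conductor `N_b`,
`b² ≤ N_b ≤ 368 b²`, by `conductorNorm_smul_rat`) but with `M⁺ = 110592 b⁶ k¹²`. For a prime `b ≥ 29`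
the scalings `b ≤ k ≤ b²` all lie in the window `[4, 20]` at `X = 368 b²`: `≥ b² − b` members of one
fixed conductor against `C X^{1/2}` (`ε = 1/6`) — false for `b` large (only the infinitude of primes is
used). -/

/-- Rescaled (non-minimal for `k ≥ 2`) models of `tw b`. -/
def sc (b k : ℕ) : WeierstrassCurve ℤ := ⟨0, 0, 0, -((b : ℤ) ^ 2 * (k : ℤ) ^ 4), (b : ℤ) ^ 3 * (k : ℤ) ^ 6⟩

theorem sc_c₄ (b k : ℕ) : (sc b k).c₄ = 48 * (b : ℤ) ^ 2 * (k : ℤ) ^ 4 := by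
  simp only [sc, WeierstrassCurve.c₄, WeierstrassCurve.b₂, WeierstrassCurve.b₄]; ring

theorem sc_c₆ (b k : ℕ) : (sc b k).c₆ = -864 * (b : ℤ) ^ 3 * (k : ℤ) ^ 6 := by
  simp only [sc, WeierstrassCurve.c₆, WeierstrassCurve.b₂, WeierstrassCurve.b₄, WeierstrassCurve.b₆]
  ring

theorem sc_Δ (b k : ℕ) : (sc b k).Δ = -368 * (b : ℤ) ^ 6 * (k : ℤ) ^ 12 := by
  simp only [sc, WeierstrassCurve.Δ, WeierstrassCurve.b₂, WeierstrassCurve.b₄, WeierstrassCurve.b₆,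
    WeierstrassCurve.b₈]
  ring

theorem sc_maxInv (b k : ℕ) :
    max |(sc b k).Δ| (|(sc b k).c₄| ^ 3) = 110592 * (b : ℤ) ^ 6 * (k : ℤ) ^ 12 := by
  rw [sc_Δ, sc_c₄, abs_mul, abs_mul, abs_mul, abs_mul, abs_of_nonpos (by norm_num : (-368 : ℤ) ≤ 0),
    abs_of_nonneg (by norm_num : (0 : ℤ) ≤ 48), abs_pow, abs_pow, abs_pow, abs_pow, Nat.abs_cast,
    Nat.abs_cast]
  rw [max_eq_right]
  · ring
  · have : (0 : ℤ) ≤ (b : ℤ) ^ 6 * (k : ℤ) ^ 12 := by positivity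
    nlinarith

instance sc_isElliptic (b k : ℕ) [NeZero b] [NeZero k] : ((sc b k).baseChange ℚ).IsElliptic := by
  refine ⟨?_⟩
  rw [baseChange_int_Δ, sc_Δ, isUnit_iff_ne_zero]
  have hb : (b : ℚ) ≠ 0 := by exact_mod_cast NeZero.ne b
  have hk : (k : ℚ) ≠ 0 := by exact_mod_cast NeZero.ne k
  push_cast
  exact mul_ne_zero (mul_ne_zero (by norm_num) (pow_ne_zero _ hb)) (pow_ne_zero _ hk)

/-- `sc b k ⊗ ℚ` is the variable change `u = 1/k` of `tw b ⊗ ℚ`. -/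
theorem sc_baseChange_eq_smul (b k : ℕ) (hk : (k : ℚ) ≠ 0) :
    (sc b k).baseChange ℚ = (⟨(Units.mk0 (k : ℚ) hk)⁻¹, 0, 0, 0⟩ : VariableChange ℚ) • (tw b).baseChange ℚ := by
  ext
  · simp [sc, tw, baseChange, variableChange_a₁]
  · simp [sc, tw, baseChange, variableChange_a₂]
  · simp [sc, tw, baseChange, variableChange_a₃]
  · simp [sc, tw, baseChange, variableChange_a₄]; ring
  · simp [sc, tw, baseChange, variableChange_a₆]; ring

/-- Same conductor as `tw b`. -/
theorem sc_conductorNorm (b k : ℕ) [NeZero b] (hk : (k : ℚ) ≠ 0) :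
    ((sc b k).baseChange ℚ).conductorNorm ℤ = ((tw b).baseChange ℚ).conductorNorm ℤ := by
  rw [sc_baseChange_eq_smul b k hk]
  exact conductorNorm_smul_rat _ _

/-- Conductor bounds for the (minimal) base curve `tw b`: `b² ∣ N ∣ 368 b²`. -/
theorem tw_conductor_bounds {b : ℕ} (hb : b.Prime) (h29 : 29 ≤ b) :
    b ^ 2 ∣ ((tw b).baseChange ℚ).conductorNorm ℤ ∧ ((tw b).baseChange ℚ).conductorNorm ℤ ∣ 368 * b ^ 2 := by
  haveI : NeZero b := ⟨hb.ne_zero⟩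
  have hmin := tw_isMinimalAt hb (by omega) (by omega)
  have hgen : ∀ p : Nat.Primes,
      Rat.HeightOneSpectrum.natGenerator ((Rat.HeightOneSpectrum.primesEquiv (R := ℤ)).symm p) = p :=
    Literature.NumberTheory.EllipticCurves.Rat.natGenerator_primesEquiv_symm
  have hfb : 2 ≤ ((tw b).baseChange ℚ).conductorExponent
      ((Rat.HeightOneSpectrum.primesEquiv (R := ℤ)).symm ⟨b, hb⟩) := by
    apply two_le_conductorExponent_of_dvd_Δ_of_dvd_c₄ (hmin _)
    · rw [hgen ⟨b, hb⟩, tw_Δ]; exact Dvd.intro (-368 * (b : ℤ) ^ 5) (by push_cast; ring)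
    · rw [hgen ⟨b, hb⟩, tw_c₄]; exact Dvd.intro (48 * (b : ℤ)) (by push_cast; ring)
  constructor
  · apply (Nat.Prime.pow_dvd_iff_le_factorization hb (conductorNorm_pos_holds _).ne').mpr
    rw [factorization_conductorNorm_primesEquiv_symm _ ⟨b, hb⟩]
    exact hfb
  · apply conductorNorm_dvd_of_forall_conductorExponent_le _ (by positivity)
    intro p
    set v := (Rat.HeightOneSpectrum.primesEquiv (R := ℤ)).symm p with hv
    have hp : (p : ℕ).Prime := p.2
    have h0 : (368 * b ^ 2) ≠ 0 := by positivity
    by_cases hpb : (p : ℕ) = b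
    · have h5' : 5 ≤ Rat.HeightOneSpectrum.natGenerator v := by rw [hgen p, hpb]; omega
      have hle := (conductorExponent_le_two_of_five_le_natGenerator_holds ((tw b).baseChange ℚ) v) h5'
      refine hle.trans ?_
      apply (Nat.Prime.pow_dvd_iff_le_factorization hp h0).mp
      rw [hpb]; exact Dvd.intro_left 368 rfl
    · by_cases hpΔ : ((Rat.HeightOneSpectrum.natGenerator v : ℕ) : ℤ) ∣ (tw b).Δ
      · have e : -(-368 * (b : ℤ) ^ 6) = ((368 * b ^ 6 : ℕ) : ℤ) := by push_cast; ring
        rw [hgen p, tw_Δ] at hpΔ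
        have hp368 : (p : ℕ) ∣ 368 := by
          have h1 : (p : ℕ) ∣ 368 * b ^ 6 := by
            have : ((p : ℕ) : ℤ) ∣ ((368 * b ^ 6 : ℕ) : ℤ) := by
              rw [← dvd_neg, e] at hpΔ; exact hpΔ
            exact_mod_cast this
          rcases (Nat.Prime.dvd_mul hp).mp h1 with h | h
          · exact h
          · exact absurd ((Nat.prime_dvd_prime_iff_eq hp hb).mp (hp.dvd_of_dvd_pow h)) hpb
        have hp2or23 : (p : ℕ) = 2 ∨ (p : ℕ) = 23 := by
          have : (p : ℕ) ∣ 2 ^ 4 * 23 := by norm_num; exact hp368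
          rcases (Nat.Prime.dvd_mul hp).mp this with h | h
          · exact Or.inl ((Nat.prime_dvd_prime_iff_eq hp Nat.prime_two).mp (hp.dvd_of_dvd_pow h))
          · exact Or.inr ((Nat.prime_dvd_prime_iff_eq hp (by norm_num)).mp h)
        have hbodd2 : ¬ (2 : ℕ) ∣ b := fun h => by
          have := (Nat.prime_dvd_prime_iff_eq Nat.prime_two hb).mp h; omega
        have hb23 : ¬ (23 : ℕ) ∣ b := fun h => by
          have := (Nat.prime_dvd_prime_iff_eq (by norm_num) hb).mp h; omega
        rcases hp2or23 with h2 | h23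
        · -- `2^5 ∤ 368 b^6`
          have hlt : ((tw b).baseChange ℚ).conductorExponent v < 5 := by
            apply conductorExponent_lt_of_not_pow_dvd (hmin v)
            rw [hgen p, h2, tw_Δ]
            intro hd
            have hd' : 2 ^ 5 ∣ 368 * b ^ 6 := by
              rw [← dvd_neg, e] at hd
              exact_mod_cast hd
            have hcop : Nat.Coprime (2 ^ 5) (b ^ 6) :=
              Nat.Coprime.pow _ _ ((Nat.Prime.coprime_iff_not_dvd Nat.prime_two).mpr hbodd2)
            have := hcop.dvd_of_dvd_mul_right hd'
            norm_num at this
          have : 4 ≤ (368 * b ^ 2).factorization (p : ℕ) := by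
            apply (Nat.Prime.pow_dvd_iff_le_factorization hp h0).mp
            rw [h2]; exact Dvd.intro (23 * b ^ 2) (by ring)
          omega
        · -- `23^2 ∤ 368 b^6`
          have hlt : ((tw b).baseChange ℚ).conductorExponent v < 2 := by
            apply conductorExponent_lt_of_not_pow_dvd (hmin v)
            rw [hgen p, h23, tw_Δ]
            intro hd
            have hd' : 23 ^ 2 ∣ 368 * b ^ 6 := by
              rw [← dvd_neg, e] at hd
              exact_mod_cast hd
            have hcop : Nat.Coprime (23 ^ 2) (b ^ 6) :=
              Nat.Coprime.pow _ _ ((Nat.Prime.coprime_iff_not_dvd (by norm_num)).mpr hb23)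
            have := hcop.dvd_of_dvd_mul_right hd'
            norm_num at this
          have : 1 ≤ (368 * b ^ 2).factorization (p : ℕ) := by
            apply (Nat.Prime.pow_dvd_iff_le_factorization hp h0).mp
            rw [h23]; exact Dvd.intro (16 * b ^ 2) (by ring)
          omega
      · rw [conductorExponent_eq_zero_of_not_dvd_Δ (hmin v) hpΔ]
        exact Nat.zero_le _

/-- The crux window with the minimality clause removed. -/
def windowNoMin (κ σ X : ℝ) : Set (WeierstrassCurve ℤ) :=
  {W₀ : WeierstrassCurve ℤ | (W₀.baseChange ℚ).IsElliptic ∧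
    (W₀.a₁ = 0 ∨ W₀.a₁ = 1) ∧ (W₀.a₃ = 0 ∨ W₀.a₃ = 1) ∧ (W₀.a₂ = -1 ∨ W₀.a₂ = 0 ∨ W₀.a₂ = 1) ∧
    W₀.c₄ ≠ 0 ∧ W₀.c₆ ≠ 0 ∧
    (((W₀.baseChange ℚ).conductorNorm ℤ : ℕ) : ℝ) ≤ X ∧
    (((W₀.baseChange ℚ).conductorNorm ℤ : ℕ) : ℝ) ^ κ ≤ ((max |W₀.Δ| (|W₀.c₄| ^ 3) : ℤ) : ℝ) ∧
    ((max |W₀.Δ| (|W₀.c₄| ^ 3) : ℤ) : ℝ) ≤ (((W₀.baseChange ℚ).conductorNorm ℤ : ℕ) : ℝ) ^ σ}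

def SharpModerateLawWithoutMinimality : Prop :=
  ∀ κ σ ε : ℝ, 3 < κ → κ < 6 → 6 < σ → 0 < ε → ∃ C : ℝ, ∀ X : ℝ, 1 ≤ X →
    (Set.ncard (windowNoMin κ σ X) : ℝ) ≤ C * X ^ (1 - κ / 6 + ε)

theorem windowNoMin_finite (κ σ X : ℝ) : (windowNoMin κ σ X).Finite := by
  refine (reducedCap_finite (⌈max (1 : ℝ) (X ^ σ)⌉₊ : ℕ)).subset ?_
  intro W hW
  obtain ⟨hE, h₁, h₃, h₂, -, -, hNX, -, hM⟩ := hW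
  refine ⟨h₁, h₃, h₂, ?_⟩
  haveI := hE
  have hN1 : (1 : ℝ) ≤ (((W.baseChange ℚ).conductorNorm ℤ : ℕ) : ℝ) := by
    exact_mod_cast conductorNorm_pos_holds (W.baseChange ℚ)
  have hM' : ((max |W.Δ| (|W.c₄| ^ 3) : ℤ) : ℝ) ≤ max 1 (X ^ σ) := by
    refine hM.trans ?_
    rcases le_or_gt 0 σ with hσ | hσ
    · exact le_max_of_le_right (Real.rpow_le_rpow (by linarith) hNX hσ)
    · exact le_max_of_le_left (Real.rpow_le_one_of_one_le_of_nonpos hN1 hσ.le)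
  have : ((max |W.Δ| (|W.c₄| ^ 3) : ℤ) : ℝ) ≤ ((⌈max (1 : ℝ) (X ^ σ)⌉₊ : ℕ) : ℝ) :=
    hM'.trans (Nat.le_ceil _)
  exact_mod_cast this

/-- Membership of the scalings: `b ≥ 29` prime, `b ≤ k ≤ b²` ⟹ `sc b k ∈ windowNoMin 4 20 (368 b²)`. -/
theorem sc_mem_windowNoMin {b k : ℕ} (hb : b.Prime) (h29 : 29 ≤ b) (hbk : b ≤ k) (hkb : k ≤ b ^ 2) :
    sc b k ∈ windowNoMin 4 20 (368 * (b : ℝ) ^ 2) := by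
  haveI : NeZero b := ⟨hb.ne_zero⟩
  have hk0 : k ≠ 0 := by omega
  haveI : NeZero k := ⟨hk0⟩
  have hkQ : (k : ℚ) ≠ 0 := by exact_mod_cast hk0
  obtain ⟨hlo, hhi⟩ := tw_conductor_bounds hb h29
  rw [← sc_conductorNorm b k hkQ] at hlo hhi
  set N := ((sc b k).baseChange ℚ).conductorNorm ℤ with hN
  have hNpos : 0 < N := conductorNorm_pos_holds _
  have hloN : b ^ 2 ≤ N := Nat.le_of_dvd hNpos hlo
  have hhiN : N ≤ 368 * b ^ 2 := Nat.le_of_dvd (by positivity) hhi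
  have hloR : (b : ℝ) ^ 2 ≤ (N : ℝ) := by exact_mod_cast hloN
  have hhiR : (N : ℝ) ≤ 368 * (b : ℝ) ^ 2 := by exact_mod_cast hhiN
  have hb0 : (0 : ℝ) < b := by exact_mod_cast hb.pos
  have hbR : (29 : ℝ) ≤ b := by exact_mod_cast h29
  have hbkR : (b : ℝ) ≤ k := by exact_mod_cast hbk
  have hkbR : (k : ℝ) ≤ (b : ℝ) ^ 2 := by exact_mod_cast hkb
  have hk0R : (0 : ℝ) ≤ k := by positivity
  refine ⟨inferInstance, Or.inl rfl, Or.inl rfl, Or.inr (Or.inl rfl), ?_, ?_, hhiR, ?_, ?_⟩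
  · rw [sc_c₄]
    exact mul_ne_zero (mul_ne_zero (by norm_num) (pow_ne_zero _ (by exact_mod_cast hb.ne_zero)))
      (pow_ne_zero _ (by exact_mod_cast hk0))
  · rw [sc_c₆]
    exact mul_ne_zero (mul_ne_zero (by norm_num) (pow_ne_zero _ (by exact_mod_cast hb.ne_zero)))
      (pow_ne_zero _ (by exact_mod_cast hk0))
  · -- `N⁴ ≤ 368⁴ b⁸ ≤ 110592 b⁶ k¹²` using `k ≥ b ≥ 29`
    rw [sc_maxInv, show (4 : ℝ) = ((4 : ℕ) : ℝ) by norm_num, Real.rpow_natCast]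
    push_cast
    have hk12 : (b : ℝ) ^ 12 ≤ (k : ℝ) ^ 12 := pow_le_pow_left₀ hb0.le hbkR 12
    calc (N : ℝ) ^ 4 ≤ (368 * (b : ℝ) ^ 2) ^ 4 := pow_le_pow_left₀ (by positivity) hhiR 4
      _ = 368 ^ 4 * (b : ℝ) ^ 2 * (b : ℝ) ^ 6 := by ring
      _ ≤ 110592 * (b : ℝ) ^ 12 * (b : ℝ) ^ 6 := by
          apply mul_le_mul_of_nonneg_right _ (by positivity)
          have hb10 : (29 : ℝ) ^ 10 ≤ (b : ℝ) ^ 10 := pow_le_pow_left₀ (by norm_num) hbR 10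
          calc (368 : ℝ) ^ 4 * (b : ℝ) ^ 2 ≤ (110592 * 29 ^ 10) * (b : ℝ) ^ 2 :=
                mul_le_mul_of_nonneg_right (by norm_num) (by positivity)
            _ ≤ (110592 * (b : ℝ) ^ 10) * (b : ℝ) ^ 2 := by
                apply mul_le_mul_of_nonneg_right _ (by positivity)
                exact mul_le_mul_of_nonneg_left hb10 (by norm_num)
            _ = 110592 * (b : ℝ) ^ 12 := by ring
      _ ≤ 110592 * (k : ℝ) ^ 12 * (b : ℝ) ^ 6 := by
          apply mul_le_mul_of_nonneg_right _ (by positivity)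
          exact mul_le_mul_of_nonneg_left hk12 (by norm_num)
      _ = 110592 * (b : ℝ) ^ 6 * (k : ℝ) ^ 12 := by ring
  · -- `110592 b⁶ k¹² ≤ 110592 b³⁰ ≤ b⁴⁰ ≤ N²⁰`
    rw [sc_maxInv, show (20 : ℝ) = ((20 : ℕ) : ℝ) by norm_num, Real.rpow_natCast]
    push_cast
    have hk12 : (k : ℝ) ^ 12 ≤ ((b : ℝ) ^ 2) ^ 12 := pow_le_pow_left₀ hk0R hkbR 12
    calc (110592 : ℝ) * (b : ℝ) ^ 6 * (k : ℝ) ^ 12 ≤ 110592 * (b : ℝ) ^ 6 * ((b : ℝ) ^ 2) ^ 12 :=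
          mul_le_mul_of_nonneg_left hk12 (by positivity)
      _ = 110592 * (b : ℝ) ^ 30 := by ring
      _ ≤ (b : ℝ) ^ 10 * (b : ℝ) ^ 30 := by
          apply mul_le_mul_of_nonneg_right _ (by positivity)
          calc (110592 : ℝ) ≤ 29 ^ 10 := by norm_num
            _ ≤ (b : ℝ) ^ 10 := pow_le_pow_left₀ (by norm_num) hbR 10
      _ = ((b : ℝ) ^ 2) ^ 20 := by ring
      _ ≤ (N : ℝ) ^ 20 := pow_le_pow_left₀ (by positivity) hloR 20

theorem sc_injective (b : ℕ) (hb : b ≠ 0) : Function.Injective (sc b) := by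
  intro k k' h
  have h4 : (sc b k).a₄ = (sc b k').a₄ := by rw [h]
  simp only [sc, neg_inj] at h4
  have hb2 : ((b : ℤ) ^ 2) ≠ 0 := pow_ne_zero _ (by exact_mod_cast hb)
  have h4' : (k : ℤ) ^ 4 = (k' : ℤ) ^ 4 := mul_left_cancel₀ hb2 h4
  have h4'' : k ^ 4 = k' ^ 4 := by exact_mod_cast h4'
  exact Nat.pow_left_injective (by norm_num) h4''

theorem card_scalings_le_ncard {b : ℕ} (hb : b.Prime) (h29 : 29 ≤ b) :
    ((b ^ 2 + 1 - b : ℕ) : ℝ) ≤ (Set.ncard (windowNoMin 4 20 (368 * (b : ℝ) ^ 2)) : ℝ) := by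
  classical
  set S := Finset.Icc b (b ^ 2) with hS
  have hcard : S.card = b ^ 2 + 1 - b := by rw [hS, Nat.card_Icc]
  have hmem : ∀ k ∈ S, b ≤ k ∧ k ≤ b ^ 2 := by
    intro k hk; rw [hS, Finset.mem_Icc] at hk; exact hk
  clear_value S
  have hsub : (↑(S.image (sc b)) : Set (WeierstrassCurve ℤ)) ⊆ windowNoMin 4 20 (368 * (b : ℝ) ^ 2) := by
    intro W hW
    rw [Finset.coe_image] at hW
    obtain ⟨k, hk, rfl⟩ := hW
    obtain ⟨h1, h2⟩ := hmem k hk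
    exact sc_mem_windowNoMin hb h29 h1 h2
  have h1 : S.card = (S.image (sc b)).card :=
    (Finset.card_image_of_injective _ (sc_injective b hb.ne_zero)).symm
  have h2 : (S.image (sc b)).card = Set.ncard (↑(S.image (sc b)) : Set (WeierstrassCurve ℤ)) :=
    (Set.ncard_coe_finset _).symm
  have h3 := Set.ncard_le_ncard hsub (windowNoMin_finite _ _ _)
  have h4 : b ^ 2 + 1 - b ≤ Set.ncard (windowNoMin 4 20 (368 * (b : ℝ) ^ 2)) := by
    rw [← hcard, h1, h2]; exact h3
  exact_mod_cast h4

/-- **Minimality is load-bearing**: `¬ SharpModerateLawWithoutMinimality` (`κ = 4`, `σ = 20`,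
`ε = 1/6`; `X = 368 b²` for a large prime `b`; only the infinitude of primes is used). -/
theorem not_sharpModerateLawWithoutMinimality : ¬ SharpModerateLawWithoutMinimality := by
  intro h
  obtain ⟨C, hC⟩ := h 4 20 (1 / 6) (by norm_num) (by norm_num) (by norm_num) (by norm_num)
  -- a prime `b ≥ max 29 (40 C + 3)`
  obtain ⟨b, hbge, hb⟩ := Nat.exists_infinite_primes (29 + 40 * ⌈C⌉₊ + 3)
  have h29 : 29 ≤ b := by omega
  have hbC : 40 * C + 2 < b := by
    have h1 : C ≤ ⌈C⌉₊ := Nat.le_ceil C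
    have h2 : ((29 + 40 * ⌈C⌉₊ + 3 : ℕ) : ℝ) ≤ b := by exact_mod_cast hbge
    push_cast at h2
    linarith
  have hb0 : (0 : ℝ) < b := by exact_mod_cast hb.pos
  have hb1 : (1 : ℝ) ≤ b := by exact_mod_cast hb.one_lt.le
  have hX1 : (1 : ℝ) ≤ 368 * (b : ℝ) ^ 2 := by nlinarith
  have hlaw := hC (368 * (b : ℝ) ^ 2) hX1
  have hcount := card_scalings_le_ncard hb h29
  have hexp : (368 * (b : ℝ) ^ 2) ^ (1 - 4 / 6 + 1 / 6 : ℝ) ≤ 20 * (b : ℝ) := by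
    rw [show (1 - 4 / 6 + 1 / 6 : ℝ) = 1 / 2 by norm_num,
      Real.mul_rpow (by norm_num) (by positivity)]
    have e1 : ((b : ℝ) ^ 2) ^ (1 / 2 : ℝ) = (b : ℝ) := by
      rw [← Real.rpow_natCast (b : ℝ) 2, ← Real.rpow_mul hb0.le]
      norm_num
    have e2 : (368 : ℝ) ^ (1 / 2 : ℝ) ≤ 20 := by
      have : (20 : ℝ) = (400 : ℝ) ^ (1 / 2 : ℝ) := by
        rw [show (400 : ℝ) = 20 ^ 2 by norm_num, ← Real.rpow_natCast 20 2, ← Real.rpow_mul (by norm_num)]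
        norm_num
      rw [this]
      exact Real.rpow_le_rpow (by norm_num) (by norm_num) (by norm_num)
    rw [e1]
    exact mul_le_mul_of_nonneg_right e2 hb0.le
  -- count: `b² + 1 − b` as a real is `≥ b² − b`
  have hcnt : (b : ℝ) ^ 2 - b ≤ ((b ^ 2 + 1 - b : ℕ) : ℝ) := by
    have : b ≤ b ^ 2 + 1 := by nlinarith
    rw [Nat.cast_sub this]
    push_cast
    linarith
  rcases lt_or_ge C 0 with hC0 | hC0
  · have : C * (368 * (b : ℝ) ^ 2) ^ (1 - 4 / 6 + 1 / 6 : ℝ) < 0 :=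
      mul_neg_of_neg_of_pos hC0 (Real.rpow_pos_of_pos (by positivity) _)
    have h0 : (0 : ℝ) ≤ ((b ^ 2 + 1 - b : ℕ) : ℝ) := Nat.cast_nonneg _
    linarith
  have hB : (b : ℝ) ^ 2 - b ≤ C * (20 * b) :=
    (hcnt.trans (hcount.trans hlaw)).trans (mul_le_mul_of_nonneg_left hexp hC0)
  -- `b² − b ≤ 20 C b` ⟹ `b − 1 ≤ 20 C`, contradicting `b > 40 C + 2`
  have : (b : ℝ) - 1 ≤ 20 * C := by
    have h' : ((b : ℝ) - 1) * b ≤ (20 * C) * b := by nlinarith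
    exact le_of_mul_le_mul_right h' hb0
  linarith

/-! ## 8. Reducedness is an HONESTY clause (re-certified): without it the crux is trivially TRUE

Without `a₁, a₃ ∈ {0,1}`, `a₂ ∈ {−1,0,1}` every member comes with all its integral translates
`x ↦ x + r` (`r ∈ ℤ`): same curve, same conductor, same `c₄, c₆, Δ`, still minimal at every place
(`u = 1`). So each unreduced window is empty or infinite, its `ncard` is `0`, and the statement holds
with `C = 0` — it would say nothing. The reducedness clauses are what make the count one model per
ℚ-isomorphism class. (General DVR lemma `isMinimal_smul_of_u_eq_one` over Mathlib's `MaximalFor`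
definition of minimality.) -/

section MinimalInvariance

variable {R : Type*} [CommRing R] [IsDomain R] [IsDiscreteValuationRing R]
  {K : Type*} [Field K] [Algebra R K] [IsFractionRing R K]

/-- Minimality (Mathlib's `IsMinimal`, a `MaximalFor` over all changes of variables) is preserved by a
change of variables with `u = 1` onto an integral equation: the discriminant, hence its valuation, is
unchanged, and the competitors of `D • W` are competitors of `W`. -/
theorem isMinimal_smul_of_u_eq_one (W : WeierstrassCurve K) [hW : W.IsMinimal R]
    (D : VariableChange K) (hu : D.u = 1) (hint : (D • W).IsIntegral R) : (D • W).IsMinimal R := by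
  have hmax := hW.val_Δ_maximal
  haveI : W.IsIntegral R := inferInstance
  have hΔ : (D • W).Δ = W.Δ := by rw [variableChange_Δ, hu]; simp
  have hval : valuation_Δ_aux R (D • W) = valuation_Δ_aux R W := by
    apply Subtype.ext
    have h1 := valuation_Δ_aux_eq_of_isIntegral R (D • W)
    have h2 := valuation_Δ_aux_eq_of_isIntegral R W
    rw [h1, h2, hΔ]
  refine ⟨⟨by simpa using hint, ?_⟩⟩
  intro C hC hle
  simp only [smul_smul, one_mul] at hC hle ⊢
  rw [hval] at hle ⊢
  have h2 := hmax.2 hC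
  simp only [one_smul] at h2
  exact h2 hle

end MinimalInvariance

/-- Integral translate `x ↦ x + r` of an integral model (`u = 1`, `s = t = 0`). -/
def tr (W₀ : WeierstrassCurve ℤ) (r : ℤ) : WeierstrassCurve ℤ :=
  ⟨W₀.a₁, W₀.a₂ + 3 * r, W₀.a₃ + r * W₀.a₁, W₀.a₄ + 2 * r * W₀.a₂ + 3 * r ^ 2,
    W₀.a₆ + r * W₀.a₄ + r ^ 2 * W₀.a₂ + r ^ 3⟩

/-- The translating change of variables over `ℚ`. -/
def trVC (r : ℤ) : VariableChange ℚ := ⟨1, (r : ℚ), 0, 0⟩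

theorem tr_baseChange (W₀ : WeierstrassCurve ℤ) (r : ℤ) :
    (tr W₀ r).baseChange ℚ = trVC r • W₀.baseChange ℚ := by
  ext
  · simp [tr, trVC, baseChange, variableChange_a₁]
  · simp [tr, trVC, baseChange, variableChange_a₂]
  · simp [tr, trVC, baseChange, variableChange_a₃]
  · simp [tr, trVC, baseChange, variableChange_a₄]
  · simp [tr, trVC, baseChange, variableChange_a₆]

theorem tr_c₄ (W₀ : WeierstrassCurve ℤ) (r : ℤ) : (tr W₀ r).c₄ = W₀.c₄ := by
  simp only [tr, WeierstrassCurve.c₄, WeierstrassCurve.b₂, WeierstrassCurve.b₄]; ring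

theorem tr_c₆ (W₀ : WeierstrassCurve ℤ) (r : ℤ) : (tr W₀ r).c₆ = W₀.c₆ := by
  simp only [tr, WeierstrassCurve.c₆, WeierstrassCurve.b₂, WeierstrassCurve.b₄, WeierstrassCurve.b₆]; ring

theorem tr_Δ (W₀ : WeierstrassCurve ℤ) (r : ℤ) : (tr W₀ r).Δ = W₀.Δ := by
  simp only [tr, WeierstrassCurve.Δ, WeierstrassCurve.b₂, WeierstrassCurve.b₄, WeierstrassCurve.b₆,
    WeierstrassCurve.b₈]; ring

theorem tr_isElliptic (W₀ : WeierstrassCurve ℤ) [h : (W₀.baseChange ℚ).IsElliptic] (r : ℤ) :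
    ((tr W₀ r).baseChange ℚ).IsElliptic := by
  refine ⟨?_⟩
  have := h.isUnit
  rw [baseChange_int_Δ] at this ⊢
  rwa [tr_Δ]

theorem tr_conductorNorm (W₀ : WeierstrassCurve ℤ) [(W₀.baseChange ℚ).IsElliptic] (r : ℤ) :
    ((tr W₀ r).baseChange ℚ).conductorNorm ℤ = (W₀.baseChange ℚ).conductorNorm ℤ := by
  rw [tr_baseChange]; exact conductorNorm_smul_rat _ _

/-- Translates of a minimal model are minimal. -/
theorem tr_isMinimalAt (W₀ : WeierstrassCurve ℤ) (v : HeightOneSpectrum ℤ)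
    (h : (W₀.baseChange ℚ).IsMinimalAt v) (r : ℤ) : ((tr W₀ r).baseChange ℚ).IsMinimalAt v := by
  have key : ((tr W₀ r).baseChange ℚ).baseChange (v.adicCompletion ℚ) =
      ((trVC r).baseChange (v.adicCompletion ℚ)) • (W₀.baseChange ℚ).baseChange (v.adicCompletion ℚ) := by
    rw [tr_baseChange]
    simp only [baseChange, VariableChange.baseChange, map_variableChange]
  have hint : (((trVC r).baseChange (v.adicCompletion ℚ)) •
      (W₀.baseChange ℚ).baseChange (v.adicCompletion ℚ)).IsIntegral (v.adicCompletionIntegers ℚ) := by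
    rw [← key]; exact isIntegralAt_baseChange_int v (tr W₀ r)
  unfold IsMinimalAt at h ⊢
  rw [key]
  haveI := h
  exact isMinimal_smul_of_u_eq_one _ _ (by simp [trVC, VariableChange.baseChange, VariableChange.map]) hint

theorem tr_injective (W₀ : WeierstrassCurve ℤ) : Function.Injective (tr W₀) := by
  intro r r' h
  have h2 : (tr W₀ r).a₂ = (tr W₀ r').a₂ := by rw [h]
  simp only [tr] at h2
  omega

/-- The crux window WITHOUT the reducedness clauses. -/
def windowUnred (κ σ X : ℝ) : Set (WeierstrassCurve ℤ) :=
  {W₀ : WeierstrassCurve ℤ | (W₀.baseChange ℚ).IsElliptic ∧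
    (∀ v : HeightOneSpectrum ℤ, (W₀.baseChange ℚ).IsMinimalAt v) ∧
    W₀.c₄ ≠ 0 ∧ W₀.c₆ ≠ 0 ∧
    (((W₀.baseChange ℚ).conductorNorm ℤ : ℕ) : ℝ) ≤ X ∧
    (((W₀.baseChange ℚ).conductorNorm ℤ : ℕ) : ℝ) ^ κ ≤ ((max |W₀.Δ| (|W₀.c₄| ^ 3) : ℤ) : ℝ) ∧
    ((max |W₀.Δ| (|W₀.c₄| ^ 3) : ℤ) : ℝ) ≤ (((W₀.baseChange ℚ).conductorNorm ℤ : ℕ) : ℝ) ^ σ}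

theorem tr_mem_windowUnred {κ σ X : ℝ} {W₀ : WeierstrassCurve ℤ} (h : W₀ ∈ windowUnred κ σ X) (r : ℤ) :
    tr W₀ r ∈ windowUnred κ σ X := by
  obtain ⟨hE, hmin, hc₄, hc₆, hNX, hlo, hhi⟩ := h
  haveI := hE
  refine ⟨tr_isElliptic W₀ r, fun v => tr_isMinimalAt W₀ v (hmin v) r, ?_, ?_, ?_, ?_, ?_⟩
  · rwa [tr_c₄]
  · rwa [tr_c₆]
  · rwa [tr_conductorNorm]
  · rwa [tr_conductorNorm, tr_Δ, tr_c₄]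
  · rwa [tr_conductorNorm, tr_Δ, tr_c₄]

/-- Every unreduced window is empty or infinite, so its `ncard` is `0`. -/
theorem windowUnred_ncard (κ σ X : ℝ) : Set.ncard (windowUnred κ σ X) = 0 := by
  rcases (windowUnred κ σ X).eq_empty_or_nonempty with h | ⟨W₀, hW₀⟩
  · rw [h, Set.ncard_empty]
  · apply Set.Infinite.ncard
    exact Set.infinite_of_injective_forall_mem (tr_injective W₀) (fun r => tr_mem_windowUnred hW₀ r)

/-- `SharpModerateLaw` with the reducedness clauses removed. -/
def SharpModerateLawUnreduced : Prop :=
  ∀ κ σ ε : ℝ, 3 < κ → κ < 6 → 6 < σ → 0 < ε → ∃ C : ℝ, ∀ X : ℝ, 1 ≤ X →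
    (Set.ncard (windowUnred κ σ X) : ℝ) ≤ C * X ^ (1 - κ / 6 + ε)

/-- **Reducedness is an honesty clause**: the unreduced statement is TRIVIALLY true (`C = 0`). -/
theorem sharpModerateLawUnreduced_trivial : SharpModerateLawUnreduced := by
  intro κ σ ε _ _ _ _
  refine ⟨0, fun X _ => ?_⟩
  rw [windowUnred_ncard]; simp

/-! ## 9. Tightness near κ = 4 (re-certified instance): the exponent cannot be lowered by 1/20 at κ = 3.9

The reduced minimal Frey models `fr b` of `1 + b² = (b² + 1)` (`b` prime, reduced by the translate
`x ↦ x − (b²−1)/3`) have `b ∣ N ∣ 2¹⁰ rad(b²(b²+1))`, so `b ≤ N ≤ 2¹¹ b³`, and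
`4096 b¹² ≤ M⁺ ≤ 110592 b¹²` (the `c₄³` term): generalized ratio `→ 4`. For `b ≥ 2¹⁰³` they lie in the
window `[39/10, 14]` at every `X ≥ 2¹¹ b³`, giving `T_[3.9,14](X) ≫ X^{1/3}/log X`, which is NOT
`O(X^{3/10})` — while the law allows `X^{0.35+ε}`. So at κ = 3.9 the true exponent is pinned in
`[1/3, 0.35]`: the crux's exponent cannot be lowered by `η = 1/20` (general η: gen 1's
`not_sharpModerateLaw_lowered`; every κ: the twist families of F3'). -/

open Literature.NumberTheory.EllipticCurves in
/-- The Frey model of `1 + b² = b² + 1`. -/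
def fm (b : ℕ) : WeierstrassCurve ℤ := freyIntModel 1 ((b : ℤ) ^ 2)

/-- Its reduced translate (`a₂ = b² − 1 ↦ 0`). -/
def fr (b : ℕ) : WeierstrassCurve ℤ := tr (fm b) (-(((b : ℤ) ^ 2 - 1) / 3))

theorem three_dvd_sq_sub_one {b : ℕ} (hb : b.Prime) (h5 : 5 ≤ b) : (3 : ℤ) ∣ (b : ℤ) ^ 2 - 1 := by
  have h3 : ¬ (3 : ℕ) ∣ b := fun h => by
    have := (Nat.prime_dvd_prime_iff_eq Nat.prime_three hb).mp h; omega
  have : (b : ℤ) % 3 = 1 ∨ (b : ℤ) % 3 = 2 := by omega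
  rcases this with h | h
  · have : ((b : ℤ) ^ 2 - 1) % 3 = 0 := by
      rw [Int.sub_emod, pow_two, Int.mul_emod, h]; norm_num
    exact Int.dvd_of_emod_eq_zero this
  · have : ((b : ℤ) ^ 2 - 1) % 3 = 0 := by
      rw [Int.sub_emod, pow_two, Int.mul_emod, h]; norm_num
    exact Int.dvd_of_emod_eq_zero this

theorem fm_hyp0 {b : ℕ} (hb : b.Prime) : (1 : ℤ) * (b : ℤ) ^ 2 * (1 + (b : ℤ) ^ 2) ≠ 0 := by
  have : (0 : ℤ) < (b : ℤ) ^ 2 := by have := hb.pos; positivity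
  positivity

theorem fm_hyp16 {b : ℕ} (hb : b.Prime) (h5 : 5 ≤ b) : ¬ (16 : ℤ) ∣ (1 : ℤ) * (b : ℤ) ^ 2 * (1 + (b : ℤ) ^ 2) := by
  have hodd : Odd (b : ℤ) := by
    have h2 : ¬ (2 : ℕ) ∣ b := fun h => by
      have := (Nat.prime_dvd_prime_iff_eq Nat.prime_two hb).mp h; omega
    have : Odd b := Nat.odd_iff.mpr (by omega)
    exact_mod_cast this.natCast (R := ℤ)
  have h1 : (b : ℤ) ^ 2 % 4 = 1 := Int.sq_mod_four_eq_one_of_odd hodd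
  have hodd2 : Odd ((b : ℤ) ^ 2) := hodd.pow
  have h2 : ((b : ℤ) ^ 2) ^ 2 % 4 = 1 := Int.sq_mod_four_eq_one_of_odd hodd2
  intro h
  have h4 : (4 : ℤ) ∣ (b : ℤ) ^ 2 + ((b : ℤ) ^ 2) ^ 2 := by
    have e : (1 : ℤ) * (b : ℤ) ^ 2 * (1 + (b : ℤ) ^ 2) = (b : ℤ) ^ 2 + ((b : ℤ) ^ 2) ^ 2 := by ring
    rw [← e]; exact dvd_trans (by norm_num) h
  omega

theorem fm_c₄ (b : ℕ) : (fm b).c₄ = 16 * (1 + (b : ℤ) ^ 2 + (b : ℤ) ^ 4) := by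
  rw [fm, Literature.NumberTheory.EllipticCurves.freyIntModel_c₄]; ring

theorem fm_c₆ (b : ℕ) : (fm b).c₆ = -32 * ((b : ℤ) ^ 2 - 1) * (2 * ((b : ℤ) ^ 2 - 1) ^ 2 + 9 * (b : ℤ) ^ 2) := by
  simp only [fm, Literature.NumberTheory.EllipticCurves.freyIntModel, WeierstrassCurve.c₆,
    WeierstrassCurve.b₂, WeierstrassCurve.b₄, WeierstrassCurve.b₆]
  ring

theorem fm_Δ (b : ℕ) : (fm b).Δ = 16 * (b : ℤ) ^ 4 * (1 + (b : ℤ) ^ 2) ^ 2 := by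
  rw [fm, Literature.NumberTheory.EllipticCurves.freyIntModel_Δ]; ring

theorem fr_a₁ (b : ℕ) : (fr b).a₁ = 0 := rfl
theorem fr_a₃ (b : ℕ) : (fr b).a₃ = 0 := by
  simp [fr, tr, fm, Literature.NumberTheory.EllipticCurves.freyIntModel]
theorem fr_a₂ {b : ℕ} (hb : b.Prime) (h5 : 5 ≤ b) : (fr b).a₂ = 0 := by
  obtain ⟨k, hk⟩ := three_dvd_sq_sub_one hb h5
  simp only [fr, tr, fm, Literature.NumberTheory.EllipticCurves.freyIntModel]
  rw [hk]
  have : (3 : ℤ) * k / 3 = k := by simp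
  rw [this]; ring

/-- Conductor bounds `b ∣ N ∣ 2¹⁰ rad(b²(b²+1))`, hence `b ≤ N ≤ 2¹¹ b³`. -/
theorem fm_conductor_bounds {b : ℕ} (hb : b.Prime) (h5 : 5 ≤ b) :
    b ≤ ((fm b).baseChange ℚ).conductorNorm ℤ ∧ ((fm b).baseChange ℚ).conductorNorm ℤ ≤ 2048 * b ^ 3 := by
  have h0 := fm_hyp0 hb
  have h16 := fm_hyp16 hb h5
  have hcop : IsCoprime (1 : ℤ) ((b : ℤ) ^ 2) := isCoprime_one_left
  haveI hE : ((fm b).baseChange ℚ).IsElliptic := Literature.NumberTheory.EllipticCurves.isElliptic_freyIntModel h0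
  have hmin : ∀ v, ((fm b).baseChange ℚ).IsMinimalAt v :=
    Literature.NumberTheory.EllipticCurves.isMinimalAt_freyIntModel hcop h0 h16
  constructor
  · -- `f_b = 1`, so `b ∣ N`
    have hgen := Literature.NumberTheory.EllipticCurves.Rat.natGenerator_primesEquiv_symm (⟨b, hb⟩ : Nat.Primes)
    set v := (Rat.HeightOneSpectrum.primesEquiv (R := ℤ)).symm ⟨b, hb⟩ with hv
    have hf : ((fm b).baseChange ℚ).conductorExponent v = 1 := by
      apply conductorExponent_eq_one_of_dvd_Δ_of_not_dvd_c₄ (hmin v)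
      · rw [hgen, fm_Δ]
        exact Dvd.intro (16 * (b : ℤ) ^ 3 * (1 + (b : ℤ) ^ 2) ^ 2) (by push_cast; ring)
      · rw [hgen, fm_c₄]
        intro hd
        have hd' : (b : ℤ) ∣ 16 := by
          have e : (16 : ℤ) = 16 * (1 + (b : ℤ) ^ 2 + (b : ℤ) ^ 4) - b * (16 * b + 16 * (b : ℤ) ^ 3) := by ring
          rw [e]; exact dvd_sub hd (Dvd.intro _ rfl)
        have : (b : ℕ) ∣ 16 := by exact_mod_cast hd'
        have hb2 : b = 2 := (Nat.prime_dvd_prime_iff_eq hb Nat.prime_two).mp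
          (hb.dvd_of_dvd_pow (show b ∣ 2 ^ 4 by norm_num; exact this))
        omega
    have hdvd : b ∣ ((fm b).baseChange ℚ).conductorNorm ℤ := by
      apply Nat.dvd_of_factorization_pos
      rw [factorization_conductorNorm_primesEquiv_symm _ ⟨b, hb⟩, ← hv, hf]; exact one_ne_zero
    exact Nat.le_of_dvd (conductorNorm_pos_holds _) hdvd
  · have hd := Literature.NumberTheory.EllipticCurves.conductorNorm_freyIntModel_dvd hcop h0 h16
    have hrad : UniqueFactorizationMonoid.radical ((1 : ℤ) * (b : ℤ) ^ 2 * (1 + (b : ℤ) ^ 2)).natAbs ≤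
        b * (1 + b ^ 2) := by
      have e : ((1 : ℤ) * (b : ℤ) ^ 2 * (1 + (b : ℤ) ^ 2)).natAbs = b ^ 2 * (1 + b ^ 2) := by
        have : (1 : ℤ) * (b : ℤ) ^ 2 * (1 + (b : ℤ) ^ 2) = ((b ^ 2 * (1 + b ^ 2) : ℕ) : ℤ) := by push_cast; ring
        rw [this, Int.natAbs_natCast]
      rw [e]
      have h1 : UniqueFactorizationMonoid.radical (b ^ 2 * (1 + b ^ 2)) ∣
          UniqueFactorizationMonoid.radical (b ^ 2) * UniqueFactorizationMonoid.radical (1 + b ^ 2) :=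
        UniqueFactorizationMonoid.radical_mul_dvd
      have h2 : UniqueFactorizationMonoid.radical (b ^ 2) = b := by
        rw [UniqueFactorizationMonoid.radical_pow _ (by norm_num),
          UniqueFactorizationMonoid.radical_of_prime (Nat.prime_iff.mp hb)]; simp
      have h3 : UniqueFactorizationMonoid.radical (1 + b ^ 2) ≤ 1 + b ^ 2 :=
        Nat.radical_le_self_iff.mpr (by positivity)
      rw [h2] at h1
      calc UniqueFactorizationMonoid.radical (b ^ 2 * (1 + b ^ 2))
          ≤ b * UniqueFactorizationMonoid.radical (1 + b ^ 2) :=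
            Nat.le_of_dvd (Nat.mul_pos hb.pos (Nat.radical_pos _)) h1
        _ ≤ b * (1 + b ^ 2) := Nat.mul_le_mul_left _ h3
    have hle : ((fm b).baseChange ℚ).conductorNorm ℤ ≤
        2 ^ 10 * UniqueFactorizationMonoid.radical ((1 : ℤ) * (b : ℤ) ^ 2 * (1 + (b : ℤ) ^ 2)).natAbs :=
      Nat.le_of_dvd (by positivity) hd
    calc ((fm b).baseChange ℚ).conductorNorm ℤ
        ≤ 2 ^ 10 * UniqueFactorizationMonoid.radical ((1 : ℤ) * (b : ℤ) ^ 2 * (1 + (b : ℤ) ^ 2)).natAbs := hle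
      _ ≤ 2 ^ 10 * (b * (1 + b ^ 2)) := Nat.mul_le_mul_left _ hrad
      _ ≤ 2048 * b ^ 3 := by
          have : 1 + b ^ 2 ≤ 2 * b ^ 2 := by have := hb.one_lt; nlinarith
          nlinarith

/-- Real-power bookkeeping: `x ^ (p/q) ≤ y` from `x ^ p ≤ y ^ q`. -/
theorem rpow_div_le_of_pow_le {x y : ℝ} (hx : 0 ≤ x) (hy : 0 ≤ y) {p q : ℕ} (hq : q ≠ 0)
    (h : x ^ p ≤ y ^ q) : x ^ ((p : ℝ) / q) ≤ y := by
  have hq' : (q : ℝ) ≠ 0 := by exact_mod_cast hq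
  have e1 : x ^ ((p : ℝ) / q) = (x ^ p) ^ ((1 : ℝ) / q) := by
    rw [← Real.rpow_natCast x p, ← Real.rpow_mul hx]; congr 1; field_simp
  have e2 : y = (y ^ q) ^ ((1 : ℝ) / q) := by
    rw [← Real.rpow_natCast y q, ← Real.rpow_mul hy]
    rw [show ((q : ℕ) : ℝ) * (1 / q) = 1 by field_simp, Real.rpow_one]
  rw [e1, e2]
  exact Real.rpow_le_rpow (by positivity) h (by positivity)

set_option exponentiation.threshold 2048 in
/-- Membership: `b` prime, `2¹⁰³ ≤ b`, `2048 b³ ≤ X` ⟹ `fr b ∈ window (39/10) 14 X`. -/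
theorem fr_mem_window {b : ℕ} (hb : b.Prime) (hB : 2 ^ 103 ≤ b) {X : ℝ} (hX : 2048 * (b : ℝ) ^ 3 ≤ X) :
    fr b ∈ window (39 / 10) 14 X := by
  have h5 : 5 ≤ b := le_trans (by norm_num) hB
  have h0 := fm_hyp0 hb
  have h16 := fm_hyp16 hb h5
  have hcop : IsCoprime (1 : ℤ) ((b : ℤ) ^ 2) := isCoprime_one_left
  haveI hE : ((fm b).baseChange ℚ).IsElliptic := Literature.NumberTheory.EllipticCurves.isElliptic_freyIntModel h0
  have hmin : ∀ v, ((fm b).baseChange ℚ).IsMinimalAt v :=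
    Literature.NumberTheory.EllipticCurves.isMinimalAt_freyIntModel hcop h0 h16
  obtain ⟨hlo, hhi⟩ := fm_conductor_bounds hb h5
  have hN : ((fr b).baseChange ℚ).conductorNorm ℤ = ((fm b).baseChange ℚ).conductorNorm ℤ := tr_conductorNorm _ _
  set N := ((fr b).baseChange ℚ).conductorNorm ℤ with hNdef
  rw [← hN] at hlo hhi
  have hb0 : (0 : ℝ) < b := by exact_mod_cast hb.pos
  have hbR : (2 : ℝ) ^ 103 ≤ b := by exact_mod_cast hB
  have hb1 : (1 : ℝ) ≤ b := le_trans (by norm_num) hbR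
  have hloR : (b : ℝ) ≤ N := by exact_mod_cast hlo
  have hhiR : (N : ℝ) ≤ 2048 * (b : ℝ) ^ 3 := by exact_mod_cast hhi
  have hN0 : (0 : ℝ) ≤ N := by positivity
  -- invariants of `fr b`
  have hc₄ : (fr b).c₄ = 16 * (1 + (b : ℤ) ^ 2 + (b : ℤ) ^ 4) := by rw [fr, tr_c₄, fm_c₄]
  have hΔ : (fr b).Δ = 16 * (b : ℤ) ^ 4 * (1 + (b : ℤ) ^ 2) ^ 2 := by rw [fr, tr_Δ, fm_Δ]
  -- bounds on `M⁺`
  have hMlo : (4096 : ℝ) * (b : ℝ) ^ 12 ≤ ((max |(fr b).Δ| (|(fr b).c₄| ^ 3) : ℤ) : ℝ) := by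
    have : (4096 : ℤ) * (b : ℤ) ^ 12 ≤ max |(fr b).Δ| (|(fr b).c₄| ^ 3) := by
      refine le_trans ?_ (le_max_right _ _)
      rw [hc₄, abs_of_nonneg (by positivity)]
      have : (16 : ℤ) * (b : ℤ) ^ 4 ≤ 16 * (1 + (b : ℤ) ^ 2 + (b : ℤ) ^ 4) := by nlinarith [sq_nonneg (b : ℤ)]
      calc (4096 : ℤ) * (b : ℤ) ^ 12 = (16 * (b : ℤ) ^ 4) ^ 3 := by ring
        _ ≤ (16 * (1 + (b : ℤ) ^ 2 + (b : ℤ) ^ 4)) ^ 3 := pow_le_pow_left₀ (by positivity) this 3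
    exact_mod_cast this
  have hMhi : ((max |(fr b).Δ| (|(fr b).c₄| ^ 3) : ℤ) : ℝ) ≤ 110592 * (b : ℝ) ^ 12 := by
    have hb1Z : (1 : ℤ) ≤ b := by exact_mod_cast hb.one_lt.le
    have : max |(fr b).Δ| (|(fr b).c₄| ^ 3) ≤ (110592 : ℤ) * (b : ℤ) ^ 12 := by
      apply max_le
      · rw [hΔ, abs_of_nonneg (by positivity)]
        have h1 : (1 : ℤ) + (b : ℤ) ^ 2 ≤ 2 * (b : ℤ) ^ 2 := by nlinarith
        calc (16 : ℤ) * (b : ℤ) ^ 4 * (1 + (b : ℤ) ^ 2) ^ 2 ≤ 16 * (b : ℤ) ^ 4 * (2 * (b : ℤ) ^ 2) ^ 2 := by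
              apply mul_le_mul_of_nonneg_left (pow_le_pow_left₀ (by positivity) h1 2) (by positivity)
          _ = 64 * (b : ℤ) ^ 8 := by ring
          _ ≤ 110592 * (b : ℤ) ^ 12 := by
              have : (b : ℤ) ^ 8 ≤ (b : ℤ) ^ 12 := pow_le_pow_right₀ hb1Z (by norm_num)
              nlinarith [pow_nonneg (show (0:ℤ) ≤ b by positivity) 8]
      · rw [hc₄, abs_of_nonneg (by positivity)]
        have h1 : (1 : ℤ) + (b : ℤ) ^ 2 + (b : ℤ) ^ 4 ≤ 3 * (b : ℤ) ^ 4 := by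
          have : (b : ℤ) ^ 2 ≤ (b : ℤ) ^ 4 := pow_le_pow_right₀ hb1Z (by norm_num)
          have : (1 : ℤ) ≤ (b : ℤ) ^ 4 := one_le_pow₀ hb1Z
          linarith
        calc (16 * (1 + (b : ℤ) ^ 2 + (b : ℤ) ^ 4)) ^ 3 ≤ (16 * (3 * (b : ℤ) ^ 4)) ^ 3 :=
              pow_le_pow_left₀ (by positivity) (by linarith) 3
          _ = 110592 * (b : ℤ) ^ 12 := by ring
    exact_mod_cast this
  refine ⟨tr_isElliptic _ _, fun v => tr_isMinimalAt _ v (hmin v) _, Or.inl (fr_a₁ b), Or.inl (fr_a₃ b),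
    Or.inr (Or.inl (fr_a₂ hb h5)), ?_, ?_, hhiR.trans hX, ?_, ?_⟩
  · rw [hc₄]; positivity
  · rw [fr, tr_c₆, fm_c₆]
    have h1 : (0 : ℤ) < (b : ℤ) ^ 2 - 1 := by
      have : (2 : ℤ) ≤ b := by exact_mod_cast hb.two_le
      nlinarith
    have h2 : (0 : ℤ) < 2 * ((b : ℤ) ^ 2 - 1) ^ 2 + 9 * (b : ℤ) ^ 2 := by positivity
    have : (0 : ℤ) < 32 * ((b : ℤ) ^ 2 - 1) * (2 * ((b : ℤ) ^ 2 - 1) ^ 2 + 9 * (b : ℤ) ^ 2) := by positivity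
    linarith
  · -- `N^{39/10} ≤ M⁺` from `N^39 ≤ (2^11 b^3)^39 ≤ (4096 b^12)^10 ≤ M⁺^10`
    rw [show (39 / 10 : ℝ) = ((39 : ℕ) : ℝ) / (10 : ℕ) by norm_num]
    apply rpow_div_le_of_pow_le hN0 (le_trans (by positivity) hMlo) (by norm_num)
    have hb3 : (2 : ℝ) ^ 309 ≤ (b : ℝ) ^ 3 := by
      calc (2 : ℝ) ^ 309 = ((2 : ℝ) ^ 103) ^ 3 := by rw [← pow_mul]
        _ ≤ (b : ℝ) ^ 3 := pow_le_pow_left₀ (by positivity) hbR 3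
    calc (N : ℝ) ^ 39 ≤ (2048 * (b : ℝ) ^ 3) ^ 39 := pow_le_pow_left₀ hN0 hhiR 39
      _ = 2 ^ 120 * 2 ^ 309 * (b : ℝ) ^ 117 := by
          rw [show (2048 : ℝ) = 2 ^ 11 by norm_num]; ring
      _ ≤ 2 ^ 120 * (b : ℝ) ^ 3 * (b : ℝ) ^ 117 := by
          apply mul_le_mul_of_nonneg_right _ (by positivity)
          exact mul_le_mul_of_nonneg_left hb3 (by positivity)
      _ = (4096 * (b : ℝ) ^ 12) ^ 10 := by ring
      _ ≤ ((max |(fr b).Δ| (|(fr b).c₄| ^ 3) : ℤ) : ℝ) ^ 10 := pow_le_pow_left₀ (by positivity) hMlo 10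
  · -- `M⁺ ≤ 110592 b¹² ≤ b¹⁴ ≤ N¹⁴`
    rw [show (14 : ℝ) = ((14 : ℕ) : ℝ) by norm_num, Real.rpow_natCast]
    calc ((max |(fr b).Δ| (|(fr b).c₄| ^ 3) : ℤ) : ℝ) ≤ 110592 * (b : ℝ) ^ 12 := hMhi
      _ ≤ (b : ℝ) ^ 2 * (b : ℝ) ^ 12 := by
          apply mul_le_mul_of_nonneg_right _ (by positivity)
          calc (110592 : ℝ) ≤ (2 ^ 103) ^ 2 := by norm_num
            _ ≤ (b : ℝ) ^ 2 := pow_le_pow_left₀ (by positivity) hbR 2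
      _ = (b : ℝ) ^ 14 := by ring
      _ ≤ (N : ℝ) ^ 14 := pow_le_pow_left₀ hb0.le hloR 14

theorem fr_injective : Set.InjOn fr {b | b.Prime ∧ 5 ≤ b} := by
  intro b hb b' hb' h
  have h4 : (fr b).c₄ = (fr b').c₄ := by rw [h]
  rw [fr, fr, tr_c₄, tr_c₄, fm_c₄, fm_c₄] at h4
  have h4' : (1 : ℤ) + (b : ℤ) ^ 2 + (b : ℤ) ^ 4 = 1 + (b' : ℤ) ^ 2 + (b' : ℤ) ^ 4 := by linarith
  have hmono : StrictMono (fun n : ℕ => 1 + n ^ 2 + n ^ 4) := by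
    intro m n hmn
    have : m ^ 2 < n ^ 2 := Nat.pow_lt_pow_left hmn (by norm_num)
    have : m ^ 4 < n ^ 4 := Nat.pow_lt_pow_left hmn (by norm_num)
    simp only; omega
  have h4'' : 1 + b ^ 2 + b ^ 4 = 1 + b' ^ 2 + b' ^ 4 := by exact_mod_cast h4'
  exact hmono.injective h4''

theorem card_primesIoc_le_T (T₀ : ℕ) :
    ((primesIoc (2 ^ 103) T₀).card : ℝ) ≤ (T (39 / 10) 14 (2048 * (T₀ : ℝ) ^ 3) : ℝ) := by
  classical
  set S := primesIoc (2 ^ 103) T₀ with hS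
  have hmem : ∀ b ∈ S, b.Prime ∧ 2 ^ 103 + 1 ≤ b ∧ b ≤ T₀ := by
    intro b hb
    rw [hS, primesIoc, Finset.mem_filter, Finset.mem_Ioc] at hb
    exact ⟨hb.2, hb.1.1, hb.1.2⟩
  clear_value S
  have hsub : (↑(S.image fr) : Set (WeierstrassCurve ℤ)) ⊆ window (39 / 10) 14 (2048 * (T₀ : ℝ) ^ 3) := by
    intro W hW
    rw [Finset.coe_image] at hW
    obtain ⟨b, hb, rfl⟩ := hW
    obtain ⟨hp, h1, hbT⟩ := hmem b hb
    refine fr_mem_window hp (by omega) ?_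
    have : (b : ℝ) ≤ T₀ := by exact_mod_cast hbT
    have : (b : ℝ) ^ 3 ≤ (T₀ : ℝ) ^ 3 := pow_le_pow_left₀ (by positivity) this 3
    linarith
  have hinj : Set.InjOn fr ↑S := by
    intro b hb b' hb' h
    have h5 : 5 ≤ b := le_trans (by norm_num) (hmem b hb).2.1
    have h5' : 5 ≤ b' := le_trans (by norm_num) (hmem b' hb').2.1
    exact fr_injective ⟨(hmem b hb).1, h5⟩ ⟨(hmem b' hb').1, h5'⟩ h
  have h1 : S.card = (S.image fr).card := (Finset.card_image_of_injOn hinj).symm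
  have h2 : (S.image fr).card = Set.ncard (↑(S.image fr) : Set (WeierstrassCurve ℤ)) :=
    (Set.ncard_coe_finset _).symm
  have h3 := Set.ncard_le_ncard hsub (window_finite _ _ _)
  have h4 : S.card ≤ T (39 / 10) 14 (2048 * (T₀ : ℝ) ^ 3) := by
    unfold T; rw [h1, h2]; exact h3
  exact_mod_cast h4

/-- **Tightness instance**: `T_[3.9, 14](X)` is not `O(X^{3/10})`. -/
theorem T_not_bigO_three_tenths :
    ¬ ∃ C : ℝ, ∀ X : ℝ, 1 ≤ X → (T (39 / 10) 14 X : ℝ) ≤ C * X ^ (3 / 10 : ℝ) := by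
  rintro ⟨C, hC⟩
  obtain ⟨T₁, hT₁⟩ := primesIoc_card_mul_log_ge (2 ^ 103)
  set m : ℕ := T₁ + 163840 * ⌈C⌉₊ + 2 with hm
  have hm2 : (2 : ℝ) ≤ m := by
    have : 2 ≤ m := by omega
    exact_mod_cast this
  have hm0 : (0 : ℝ) < m := by linarith
  have hmC : 163840 * C < m := by
    have h1 : C ≤ ⌈C⌉₊ := Nat.le_ceil C
    have h2 : ((T₁ + 163840 * ⌈C⌉₊ + 2 : ℕ) : ℝ) = m := by rw [hm]
    push_cast at h2
    have : (0 : ℝ) ≤ T₁ := by positivity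
    linarith
  have hT₁m : T₁ ≤ m ^ 20 := by
    calc T₁ ≤ m := by omega
      _ = m ^ 1 := (pow_one m).symm
      _ ≤ m ^ 20 := Nat.pow_le_pow_right (by omega) (by norm_num)
  clear_value m
  have hsup := hT₁ (m ^ 20) hT₁m
  have hcount := card_primesIoc_le_T (m ^ 20)
  set P : ℝ := ((primesIoc (2 ^ 103) (m ^ 20)).card : ℝ) with hP
  have hcard0 : (0 : ℝ) ≤ P := by rw [hP]; exact Nat.cast_nonneg _
  clear_value P
  push_cast at hsup hcount
  rw [Real.log_pow] at hsup
  have hlogm : Real.log m ≤ m := by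
    have := Real.log_le_sub_one_of_pos hm0; linarith
  have hX1 : (1 : ℝ) ≤ 2048 * ((m : ℝ) ^ 20) ^ 3 := by
    have : (1 : ℝ) ≤ ((m : ℝ) ^ 20) ^ 3 := one_le_pow₀ (one_le_pow₀ (by linarith))
    linarith
  have hlaw := hC (2048 * ((m : ℝ) ^ 20) ^ 3) hX1
  have hexp : (2048 * ((m : ℝ) ^ 20) ^ 3) ^ (3 / 10 : ℝ) ≤ 2048 * (m : ℝ) ^ 18 := by
    rw [Real.mul_rpow (by norm_num) (by positivity)]
    have e1 : (((m : ℝ) ^ 20) ^ 3) ^ (3 / 10 : ℝ) = (m : ℝ) ^ 18 := by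
      rw [← pow_mul, ← Real.rpow_natCast (m : ℝ) (20 * 3), ← Real.rpow_mul hm0.le]
      rw [show ((20 * 3 : ℕ) : ℝ) * (3 / 10) = ((18 : ℕ) : ℝ) by norm_num, Real.rpow_natCast]
    have e2 : (2048 : ℝ) ^ (3 / 10 : ℝ) ≤ 2048 := by
      calc (2048 : ℝ) ^ (3 / 10 : ℝ) ≤ (2048 : ℝ) ^ (1 : ℝ) :=
            Real.rpow_le_rpow_of_exponent_le (by norm_num) (by norm_num)
        _ = 2048 := Real.rpow_one _
    rw [e1]
    exact mul_le_mul_of_nonneg_right e2 (by positivity)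
  have hA : (m : ℝ) ^ 20 / 4 ≤ 20 * m * P := by
    calc (m : ℝ) ^ 20 / 4 ≤ P * (20 * Real.log m) := hsup
      _ ≤ P * (20 * m) := by
          apply mul_le_mul_of_nonneg_left _ hcard0; linarith
      _ = 20 * m * P := by ring
  rcases lt_or_ge C 0 with hC0 | hC0
  · have : C * (2048 * ((m : ℝ) ^ 20) ^ 3) ^ (3 / 10 : ℝ) < 0 :=
      mul_neg_of_neg_of_pos hC0 (Real.rpow_pos_of_pos (by positivity) _)
    linarith
  have hB : P ≤ C * (2048 * (m : ℝ) ^ 18) :=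
    (hcount.trans hlaw).trans (mul_le_mul_of_nonneg_left hexp hC0)
  have h20m : (0 : ℝ) ≤ 20 * m := by linarith
  have hD : (m : ℝ) ^ 20 / 4 ≤ 40960 * C * (m : ℝ) ^ 19 := by
    calc (m : ℝ) ^ 20 / 4 ≤ 20 * m * P := hA
      _ ≤ 20 * m * (C * (2048 * (m : ℝ) ^ 18)) := mul_le_mul_of_nonneg_left hB h20m
      _ = 40960 * C * (m : ℝ) ^ 19 := by ring
  have hm19 : (0 : ℝ) < (m : ℝ) ^ 19 := by positivity
  have hE : (m : ℝ) ≤ 163840 * C := by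
    have : (m : ℝ) ^ 20 / 4 = ((m : ℝ) / 4) * (m : ℝ) ^ 19 := by ring
    rw [this] at hD
    have := le_of_mul_le_mul_right (by linarith : (m : ℝ) / 4 * (m : ℝ) ^ 19 ≤ 40960 * C * (m : ℝ) ^ 19) hm19
    linarith
  linarith

/-- The crux with its exponent lowered by `η = 1/20`. -/
def SharpModerateLawLoweredTwentieth : Prop :=
  ∀ κ σ : ℝ, 3 < κ → κ < 6 → 6 < σ → ∃ C : ℝ, ∀ X : ℝ, 1 ≤ X →
    (T κ σ X : ℝ) ≤ C * X ^ (1 - κ / 6 - 1 / 20)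

/-- **The exponent `1 − κ/6` cannot be lowered by `1/20`** (instance at `κ = 39/10`, `σ = 14`). -/
theorem not_sharpModerateLawLoweredTwentieth : ¬ SharpModerateLawLoweredTwentieth := by
  intro h
  obtain ⟨C, hC⟩ := h (39 / 10) 14 (by norm_num) (by norm_num) (by norm_num)
  apply T_not_bigO_three_tenths
  refine ⟨C, fun X hX => ?_⟩
  have := hC X hX
  rwa [show (1 - 39 / 10 / 6 - 1 / 20 : ℝ) = 3 / 10 by norm_num] at this

end

end Summit.ABC.ABC.Cruxes.SharpModerateLaw.Disproof
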